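import Mathlib.Analysis.SpecialFunctions.Log.Base
import Mathlib.Analysis.SpecialFunctions.Pow.Real
import Literature.Computability.AlgebraicComplexity.AsymptoticSpectrum
import Literature.Computability.AlgebraicComplexity.RectangularExponent
import Literature.Computability.AlgebraicComplexity.QuantumFunctionals
import HarnessLib

/-!
# Barrier: rectangular matrix multiplication via a fixed intermediate tensor (Christandl–Le Gall–Lysikov–Zuiddam)

Topic `Literature/Barriers/MatrixMultiplication` (D-0021 barrier catalogue for the summit
`MatrixMultiplication`, `ω(ℂ) = 2`; this entry concerns the natural STRENGTHENING `α = 1` — the dual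
exponent, `α = 1 ⟹ ω = 2` — and the rectangular exponents `ω(p)` of
`Literature/Computability/AlgebraicComplexity/RectangularExponent.lean`).

Source: M. Christandl, F. Le Gall, V. Lysikov, J. Zuiddam, *Barriers for rectangular matrix
multiplication*, comput. complexity 34 (2025), art. 4; author version arXiv:2003.03019**v2**
(7 Nov 2025), whose numbering and Table 1 are used throughout (the store holds v1 of 2020 =
`ChristandlLeGallLysikovZuiddam2020`, whose numbering — Lemma 3.1, Def. 3.10, Thm. 3.11, Rem. 3.22 —
differs and whose headline constant `0.625` is the one vendored for the `α`-barrier, see "Numerics";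
v2 was read from the arXiv PDF: abstract and §1.3.1 p. 1–4, §2 and Thm. 2.1 p. 8–9,
Def. 3.1 p. 10, Lemma 3.2 – Lemma 3.8 p. 10–11, Def. 3.9 – Rem. 3.11 p. 12, Def. 3.12 – Thm. 3.15
p. 13, §3.5 Lemma 3.16 – Thm. 3.21 p. 13–15, §3.6 Thm. 3.22 and Rem. 3.23 p. 15, §4.1 eq. (4),
Lemma 4.1, Lemma 4.2, eq. (5) p. 16, §4.2–4.3 p. 16–17, §4.4 Tables 1–3 p. 18–19, App. A p. 23–24).

## Catalogue entry

The D-0021 structured block is in the docstring of the catalogue declaration `RectangularBarrier` at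
the end of this file.

## Content

* **Technique class (CLLZ Def. 3.9, Def. 3.12, §3.6), as Lean definitions.**
  `IsTMethodReduction K T k n m s` — one reduction `T^{⊗k} ≥ ⟨n,n,m⟩^{⊕s}` (restriction; the
  `s`-fold direct sum written `⟨s⟩ ⊗ ⟨n,n,m⟩`, as CLLZ do after Thm. 2.1); `tMethodBound r k n s =
  k log_n r − log_n s` — the bound it yields on `ω(p)` when `R̃(T) ≤ r` and `m ≥ n^p` (Thm. 2.1);
  `IsTMethodBound K T p ω̂` — "`ω̂` is an upper bound on `ω(p)` obtained by a `T`-method": some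
  `r ≥ R̃(T)` and, for every `ε > 0`, a reduction with `n ≥ 2`, `s ≥ 1`, `m ≥ n^{p−ε}` and bound
  `≤ ω̂ + ε` (this ε-closure contains the `inf` over any collection of reductions of Def. 3.9,
  `IsTMethodBound.sInf`, and the `lim inf` of the asymptotic `T`-methods of Def. 3.12);
  `IsTMethodAlphaBound K T p := IsTMethodBound K T p 2` — "an asymptotic `T`-method proves that `p` is a
  lower bound on `α`", i.e. proves `ω(p) ≤ 2` (Thm. 3.22 and its proof).
* **Certificates: adequate tensor parameters (CLLZ Def. 3.1).** `IsAdequate K F` for a `SpectralMap K`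
  (`AsymptoticSpectrum.lean`): values `≥ 0`, (i) `≤`-monotone, (ii) `⊗`-submultiplicative,
  (iii) MaMu-`⊗`-multiplicative `F(⟨ℓ₁ℓ₂, m₁m₂, n₁n₂⟩) = F(⟨ℓ₁,m₁,n₁⟩) F(⟨ℓ₂,m₂,n₂⟩)`, (iv)
  self-`⊕`-additive `F(T^{⊕s}) = s F(T)`, (v) `F ≤ R̃`.  Strassen's upper support functionals `ζ^θ`
  (`upperSupportPoint K θ`, a `SpectralMap` wrapper of the tree's `upperSupportFunctional`) are adequate
  (CLLZ Lemma 4.2): PROVED here (`CLLZ2025_lem42`) from the tree's named fact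
  `Strassen1991_upperSupportFunctional` ((i), (ii), (iv), normalisation), the product formula
  `ζ^θ(⟨a,b,c⟩) = a^{θ0+θ1} b^{θ1+θ2} c^{θ0+θ2}` of Lemma 4.1 (named fact `CLLZ2025_lem41`, giving (iii))
  and `ζ^θ ≤ R̃` (Def. 3.1(v) for `ζ^θ`, named fact `CLLZ2025_lem42_v`). Footnote 3 ("all elements in
  the asymptotic spectrum of tensors are adequate maps") is PROVED for the tree's
  `IsUniversalSpectralPoint` given Strassen's duality for (v) (`IsUniversalSpectralPoint.isAdequate`,
  with `⟨l₁,m₁,n₁⟩ ⊗ ⟨l₂,m₂,n₂⟩ ≅ ⟨l₁l₂,m₁m₂,n₁n₂⟩`, `⟨s+1⟩ ≅ ⟨s⟩ ⊕ ⟨1⟩` as mutual restrictions and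
  `ξ(⟨r⟩) = r`); in particular the quantum functionals over `ℂ` are adequate.
* **The barrier, PROVED for every adequate `F`** (any field):
  `IsAdequate.le_tMethodBound` — Thm. 3.10 for one reduction in format form, including the
  catalyticity term: `k log_n r − log_n s ≥ ρ · log_n F(⟨n,n,m⟩) + (ρ − 1) log_n s`, `ρ = log r / log F(T)`;
  `IsAdequate.log_map_matMul_ge` — the half of Lemma 3.7 (with Lemma 3.4/3.8) the barrier uses:
  `log F(⟨n,n,m⟩) ≥ (log₂ F(⟨2,1,1⟩) + log₂ F(⟨1,2,1⟩)) log n + log₂ F(⟨1,1,2⟩) log m`;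
  `IsAdequate.barrier` — **Thm. 1.1 = Thm. 3.15 (first part) with Lemma 3.7**: every `T`-method bound
  `ω̂` on `ω(p)` satisfies `ω̂ ≥ log₂(F(⟨2,1,1⟩) F(⟨1,2,1⟩) F(⟨1,1,2⟩)^p) · log R̃(T) / log F(T)`;
  `IsAdequate.alpha_barrier` — **Thm. 1.2 = Thm. 3.22**:
  `p ≤ 2 log F(T) / (log R̃(T) log₂ F(⟨1,1,2⟩)) − log F(⟨2,2,1⟩) / log F(⟨1,1,2⟩)`; and their
  specialisations to `ζ^θ` (eq. (5): `ω̂ ≥ ((1+θ1) + p(1−θ1)) log R̃(T)/log ζ^θ(T)` in the tree's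
  index convention; `RectangularBarrier.upperSupport`, `.alpha_upperSupport`).
  Auxiliary, proved: `TensorRestrictsTo.comap` (restriction to coordinate reindexings),
  `tensorRestrictsTo_kroneckerPow_succ`, `tensorRestrictsTo_unit_succ_kronecker`,
  `tensorRestrictsTo_matMulTensor_of_le` (zero-padding), `tensorRestrictsTo_matMulOne_kronecker`,
  `asymptoticRank_kroneckerPow_zero_le`, `logb_two_mul_log_le_log` (monotone multiplicative
  `g : ℕ → ℝ` satisfy `log g(a) ≥ log₂ g(2) · log a`, the first step of the proof of Lemma 3.7).
* **Named facts (statements only):** `CLLZ2025_lem41`, `CLLZ2025_lem42_v` (above);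
  `CLLZ2025_tMethodBound_sound` (Thm. 2.1, Def. 3.9/3.12, Rem. 3.13, footnote 1: `ω(p) ≤ ω̂`, for both
  placements `omegaRect K 1 1 p` and `omegaRect K 1 p 1` of the rectangular dimension);
  `CLLZ2025_rem323` (`ω + ωα/2 ≤ 3`, whence `α = 1 ⟹ ω ≤ 2`, proved corollary);
  `CLLZ2025_alpha_barrier_CW` (v1 abstract and §1.3.1: via `CW_q`, any `q ≥ 2`, `p ≤ 0.625`),
  `cllz2025OmegaTwoTable`/`CLLZ2025_omegaTwo_barrier_CW` (Table 1: `ω̂(2) ≥ 3.0626, …, 3.1714` for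
  `q = 2, …, 14`).
* Catalogue entry `RectangularBarrier : Prop` (conjunction of the named facts) with the D-0021 block and
  the headline corollaries.

## Design choices and wording risks

* **Which preorder.** CLLZ §3.1, footnote 4: "everything we discuss in this section also holds if
  restriction is replaced with degeneration, monomial degeneration or monomial restriction".
  Formalised for restriction (`TensorRestrictsTo`); the numerical facts, printed for degeneration
  methods (§1.3.1), are vendored for the restriction subclass (implied by print, never stronger).
* **Def. 3.1 in Lean.** `F : {tensors} → ℝ≥0` is a real-valued `SpectralMap` with `nonneg`; (iii) is
  required for positive formats `ℓᵢ, mᵢ, nᵢ ≥ 1` (CLLZ's `⟨ℓ,m,n⟩` are matrix multiplication tensors,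
  `ℓ, m, n` positive integers; a weaker requirement, so the class is not smaller than printed and the
  proved barrier not weaker); (iv) is stated for `s ≥ 1` with the `s`-fold direct sum `T^{⊕s}` encoded
  as `⟨s⟩ ⊗ T` (block-diagonal; the encoding CLLZ use after Thm. 2.1).
* **Virtual tensors avoided.** Thm. 3.10/3.15 are printed with `log F(⟨2,2,2^p⟩)`, the virtual value of
  Def. 3.3, which Lemma 3.7 evaluates as `log₂(F(⟨2,1,1⟩)F(⟨1,2,1⟩)F(⟨1,1,2⟩)^p)`; Thm. 1.1 prints the
  evaluated form, and that is the form proved here (`IsAdequate.barrier`). Of Lemma 3.7 only the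
  inequality `F(⟨a,1,1⟩) ≥ F(⟨2,1,1⟩)^{log₂ a}` (first sentence of its proof) is needed and proved
  (`logb_two_mul_log_le_log`); the `log` in front of `F(⟨2,2,2^p⟩)` is `log₂` (eq. (5)), the other
  logarithms enter through base-free ratios.
* **`⟨n,n,m⟩` and index conventions.** CLLZ's `⟨ℓ,m,n⟩` is "`ℓ × m` times `m × n`" (§1.3.2), the tree's
  `matMulTensor K ℓ m n`; `⟨n,n,m⟩`, `m ≥ n^p` is `matMulTensor K n n m`. The tree orders the three
  index types of `matMulTensor K a b c` as `(a×c, a×b, b×c)`, CLLZ as `(ab, bc, ca)`; Lemma 4.1 is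
  vendored in the tree's convention (exponent of `c` is `θ 0 + θ 2`), so eq. (5)'s
  `2θ₁ + θ₂ + θ₃ + p(θ₂ + θ₃)` reads `(1 + θ 1) + p(1 − θ 1)`. `ω(p)`: footnote 1 defines it by
  `n × ⌈n^p⌉` times `⌈n^p⌉ × n` (middle placement, the tree's `omegaRect K 1 p 1`, in which
  `dualExponentAlpha` is defined), Thm. 2.1 / Def. 3.9 use `⟨n,n,m⟩` (last placement,
  `omegaRect K 1 1 p`); the soundness fact records both.
* Junk/edge cases: `tMethodBound` has `log n` in the denominator, so reductions are required to have
  `n ≥ 2` and `s ≥ 1`; `k = 0` is allowed and handled through (v) (`F(T^{⊗0}) ≤ R̃(T^{⊗0}) ≤ 1`).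
  `IsTMethodBound` fixes `r ≥ R̃(T)` as in Def. 3.9; the barrier value uses `R̃(T)` itself. The
  barrier theorems assume `F(T) > 1` (then `F(⟨1,1,1⟩) = 1` and `F(⟨a,b,c⟩) ≥ 1`, proved), which the
  printed quotient `log R̃(T)/log F(T)` presupposes.
* **Numerics (Tables 1, 3; App. A).** The printed values are outputs of a conic solver (cvxpy): Table 1
  truncates the maximum over a grid `θ₁ ∈ {0.001, …, 0.2}` to four decimals and is vendored as printed
  (every row is reproduced by exact evaluation of eq. (5): e.g. `q = 2`: `3.062625` at `θ₁ = 0.096`;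
  reviews of p7537). Table 3 (`α` via `CW_q`, `q = 2,…,14`: `.6218 .5998 .5777 .5583 .5408 .5259 .5129
  .5001 .4914 .4772 .4692 .4614 .4529`) evaluates the §4.3 expression at `θ₁ = 0.999999`, `θ₂ = θ₃`,
  where solver error is amplified by `1/(θ₂+θ₃) = 10⁶`: the expression decreases in `θ₁` to the exact
  limit `g*(q) = 2 max{(H(P₂)+H(P₃))/2 : P on supp CW_q, P₁ uniform}/log₂(q+2) − 1`, which for `q = 2`
  is `3 − (3/2) log₂ 3 = 0.62256` (optimum `P₂ = (9/16, 3/16, 3/16, 1/16)`); since `CW_q` is tight,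
  `log₂ ζ^θ(CW_q)` equals the support-entropy maximum and `g*(q)` is exactly the best bound Thm. 3.22 with
  Lemma 4.1/4.2 gives for `CW_q`. The printed rows `q = 2, 4, 6, 11, 12, 14` (`0.6218, 0.5777, 0.5408,
  0.4772, 0.4692, 0.4529`) lie BELOW the exact values (`0.622556, 0.577983, 0.540852, 0.478505,
  0.469475, 0.453656`) and are therefore not established by the printed proof; rows `3, 5, 7–10, 13`
  are. Table 3 and the v2 headline `0.6218` are NOT vendored; the `α`-fact carries the v1 constant
  `0.625 ≥ 0.62256` (v1 abstract and §1.3.1), for `q ≥ 2` (the range of Fig. 2; for `q = 1`, not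
  tabulated, `g*(1) = 0.6407 > 0.625`).
* Not vendored: the κ-catalytic second halves of Thm. 3.10/3.15 beyond the one-reduction term in
  `le_tMethodBound`; mixed methods (§3.5, Lemma 3.16 – Thm. 3.21); Table 2 (`cw_q`) and Table 3 (see
  "Numerics"); the `CW_6` value `0.543` and the comparison with Alman–Vassilevska Williams' `0.871`
  (§1.3.1); Thm. 2.1 itself (inside the soundness fact).
* `CW_q` is written inline in the numerical facts (on `Fin (q+2)`, `q+1 = Fin.last (q+1)`), equal to
  `bigCwTensor K q` of `IrreversibilityBarrier.lean` (proposed separately); §2 of v2 prints the third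
  summand of `CW_q` as `x₀yᵢzᵢ` twice (typo for `xᵢyᵢz₀`, cf. `supp(CW_q)` in §4.2).
-/

noncomputable section

open scoped BigOperators

namespace Literature.Barriers.MatrixMultiplication

universe u

/-! ## Reindexing restrictions -/

section Reindex

variable {K : Type u} [CommSemiring K]
variable {ι κ μ ι' κ' μ' : Type*} [Fintype ι] [Fintype κ] [Fintype μ]

/-- Restriction to a coordinate reindexing / coordinate sub-tensor: for arbitrary index maps
`f, g, h`, `t ≥ ((a', b', c') ↦ t (f a') (g b') (h c'))` (take the 0/1 matrices `A a' a = [a = f a']`,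
etc.). [folklore] -/
theorem _root_.Literature.Computability.AlgebraicComplexity.TensorRestrictsTo.comap (t : ι → κ → μ → K) (f : ι' → ι) (g : κ' → κ) (h : μ' → μ) :
    Literature.Computability.AlgebraicComplexity.TensorRestrictsTo t (fun a' b' c' => t (f a') (g b') (h c')) := by
  classical
  refine ⟨fun a' a => if a = f a' then 1 else 0, fun b' b => if b = g b' then 1 else 0,
    fun c' c => if c = h c' then 1 else 0, fun a' b' c' => ?_⟩
  rw [Finset.sum_eq_single (f a') (fun a _ ha => by simp [ha]) (by simp),
    Finset.sum_eq_single (g b') (fun b _ hb => by simp [hb]) (by simp),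
    Finset.sum_eq_single (h c') (fun c _ hc => by simp [hc]) (by simp)]
  simp

/-- `t^{⊗N} ⊗ t ≥ t^{⊗(N+1)}` (in fact an isomorphism; the reindexing
`a ↦ (a ∘ castSucc, a (last N))`). [folklore] -/
theorem tensorRestrictsTo_kroneckerPow_succ (t : ι → κ → μ → K) (N : ℕ) :
    Literature.Computability.AlgebraicComplexity.TensorRestrictsTo (Literature.Computability.AlgebraicComplexity.kroneckerTensor (Literature.Computability.AlgebraicComplexity.kroneckerPow t N) t) (Literature.Computability.AlgebraicComplexity.kroneckerPow t (N + 1)) := by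
  have h : Literature.Computability.AlgebraicComplexity.kroneckerPow t (N + 1) = fun a b c =>
      Literature.Computability.AlgebraicComplexity.kroneckerTensor (Literature.Computability.AlgebraicComplexity.kroneckerPow t N) t (fun i => a (Fin.castSucc i), a (Fin.last N))
        (fun i => b (Fin.castSucc i), b (Fin.last N)) (fun i => c (Fin.castSucc i), c (Fin.last N)) := by
    funext a b c
    simp [Literature.Computability.AlgebraicComplexity.kroneckerPow, Literature.Computability.AlgebraicComplexity.kroneckerTensor, Fin.prod_univ_castSucc]
  rw [h]
  exact Literature.Computability.AlgebraicComplexity.TensorRestrictsTo.comap _ _ _ _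

/-- `⟨s+1⟩ ⊗ u ≥ (⟨s⟩ ⊗ u) ⊕ u` (in fact an isomorphism: split off the last diagonal block).
[folklore] -/
theorem tensorRestrictsTo_unit_succ_kronecker {ι₀ κ₀ μ₀ : Type*} [Fintype ι₀] [Fintype κ₀] [Fintype μ₀]
    (u : ι₀ → κ₀ → μ₀ → K) (s : ℕ) :
    Literature.Computability.AlgebraicComplexity.TensorRestrictsTo (Literature.Computability.AlgebraicComplexity.kroneckerTensor (Literature.Computability.AlgebraicComplexity.unitTensor K (s + 1)) u)
      (Literature.Computability.AlgebraicComplexity.directSumTensor (Literature.Computability.AlgebraicComplexity.kroneckerTensor (Literature.Computability.AlgebraicComplexity.unitTensor K s) u) u) := by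
  classical
  have h : Literature.Computability.AlgebraicComplexity.directSumTensor (Literature.Computability.AlgebraicComplexity.kroneckerTensor (Literature.Computability.AlgebraicComplexity.unitTensor K s) u) u = fun a b c =>
      Literature.Computability.AlgebraicComplexity.kroneckerTensor (Literature.Computability.AlgebraicComplexity.unitTensor K (s + 1)) u
        (Sum.elim (fun p => (Fin.castSucc p.1, p.2)) (fun x => (Fin.last s, x)) a)
        (Sum.elim (fun p => (Fin.castSucc p.1, p.2)) (fun x => (Fin.last s, x)) b)
        (Sum.elim (fun p => (Fin.castSucc p.1, p.2)) (fun x => (Fin.last s, x)) c) := by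
    funext a b c
    rcases a with ⟨i, a⟩ | a <;> rcases b with ⟨j, b⟩ | b <;> rcases c with ⟨l, c⟩ | c <;>
      simp [Literature.Computability.AlgebraicComplexity.directSumTensor, Literature.Computability.AlgebraicComplexity.kroneckerTensor, Fin.castSucc_ne_last, (Fin.castSucc_lt_last _).ne']
  rw [h]
  exact Literature.Computability.AlgebraicComplexity.TensorRestrictsTo.comap _ _ _ _

/-- `⟨1,1,1⟩ ⊗ T ≥ T` (in fact an isomorphism: `⟨1,1,1⟩` is the `1 × 1 × 1` tensor with entry `1`).
[folklore] -/
theorem tensorRestrictsTo_matMulOne_kronecker {ι₀ κ₀ μ₀ : Type*} [Fintype ι₀] [Fintype κ₀]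
    [Fintype μ₀] (T : ι₀ → κ₀ → μ₀ → K) :
    Literature.Computability.AlgebraicComplexity.TensorRestrictsTo (Literature.Computability.AlgebraicComplexity.kroneckerTensor (Literature.Computability.AlgebraicComplexity.matMulTensor K 1 1 1) T) T := by
  have hc := Literature.Computability.AlgebraicComplexity.TensorRestrictsTo.comap (Literature.Computability.AlgebraicComplexity.kroneckerTensor (Literature.Computability.AlgebraicComplexity.matMulTensor K 1 1 1) T)
    (fun a => (((0 : Fin 1), (0 : Fin 1)), a)) (fun b => (((0 : Fin 1), (0 : Fin 1)), b))
    (fun c => (((0 : Fin 1), (0 : Fin 1)), c))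
  convert hc using 1
  funext a b c
  simp [Literature.Computability.AlgebraicComplexity.matMulTensor]

variable (K) in
/-- Zero-padding of matrix multiplication tensors: for `k ≤ k'`, `m ≤ m'`, `n ≤ n'`, `⟨k,m,n⟩` is the
coordinate sub-tensor of `⟨k',m',n'⟩` along the embeddings `Fin.castLE` (Bläser 2013, Lemma 5.4; the
tree's `matMulTensor_eq_precomp_castLE` is the cubic case). [folklore] -/
theorem matMulTensor_eq_comap_castLE {k k' m m' n n' : ℕ} (hk : k ≤ k') (hm : m ≤ m') (hn : n ≤ n') :
    Literature.Computability.AlgebraicComplexity.matMulTensor K k m n = fun a b c => Literature.Computability.AlgebraicComplexity.matMulTensor K k' m' n'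
      (Prod.map (Fin.castLE hk) (Fin.castLE hn) a) (Prod.map (Fin.castLE hk) (Fin.castLE hm) b)
      (Prod.map (Fin.castLE hm) (Fin.castLE hn) c) := by
  funext a b c
  simp [Literature.Computability.AlgebraicComplexity.matMulTensor, Prod.map, Fin.ext_iff]

variable (K) in
/-- `⟨k',m',n'⟩ ≥ ⟨k,m,n⟩` for `k ≤ k'`, `m ≤ m'`, `n ≤ n'` (zero-padding). [folklore] -/
theorem tensorRestrictsTo_matMulTensor_of_le {k k' m m' n n' : ℕ} (hk : k ≤ k') (hm : m ≤ m')
    (hn : n ≤ n') : Literature.Computability.AlgebraicComplexity.TensorRestrictsTo (Literature.Computability.AlgebraicComplexity.matMulTensor K k' m' n') (Literature.Computability.AlgebraicComplexity.matMulTensor K k m n) := by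
  rw [matMulTensor_eq_comap_castLE K hk hm hn]
  exact Literature.Computability.AlgebraicComplexity.TensorRestrictsTo.comap _ _ _ _

/-- Transport of a value along equalities of the three dimensions (used to read
`F(⟨k·1, 1·m, 1·1⟩)` as `F(⟨k, m, 1⟩)`). [folklore] -/
theorem _root_.Literature.Computability.AlgebraicComplexity.SpectralMap.map_matMulTensor_congr (F : Literature.Computability.AlgebraicComplexity.SpectralMap K) {k k' m m' n n' : ℕ} (hk : k = k')
    (hm : m = m') (hn : n = n') : F (Literature.Computability.AlgebraicComplexity.matMulTensor K k m n) = F (Literature.Computability.AlgebraicComplexity.matMulTensor K k' m' n') := by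
  subst hk; subst hm; subst hn; rfl

end Reindex

/-! ## A real-analysis lemma (first step of the proof of CLLZ Lemma 3.7) -/

section PowerLaw

/-- For `g : ℕ → ℝ` with `g 1 = 1`, monotone and multiplicative on positive integers,
`log g(a) ≥ log₂ g(2) · log a` for every `a ≥ 1` (CLLZ, proof of Lemma 3.7: "`F(⟨a,1,1⟩) =
F(⟨2,1,1⟩)^{log a}` because if `log a ≥ b/c` then `F(⟨a,1,1⟩)^c ≥ F(⟨2,1,1⟩)^b`"; here with
`b = ⌊log₂ a^c⌋` and `c → ∞`). Only this half of the power law is used by the barrier.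
[cite: ChristandlLeGallLysikovZuiddam2025, Lemma 3.7 (proof)] -/
theorem logb_two_mul_log_le_log {g : ℕ → ℝ} (h1 : g 1 = 1)
    (hmono : ∀ ⦃a b : ℕ⦄, 1 ≤ a → a ≤ b → g a ≤ g b)
    (hmul : ∀ a b : ℕ, 1 ≤ a → 1 ≤ b → g (a * b) = g a * g b) {a : ℕ} (ha : 1 ≤ a) :
    Real.logb 2 (g 2) * Real.log a ≤ Real.log (g a) := by
  have hge : ∀ {n : ℕ}, 1 ≤ n → 1 ≤ g n := fun hn => h1 ▸ hmono le_rfl hn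
  have hpow : ∀ {n : ℕ}, 1 ≤ n → ∀ c : ℕ, g (n ^ c) = g n ^ c := by
    intro n hn c
    induction c with
    | zero => simp [h1]
    | succ c ih => rw [pow_succ, hmul _ _ (Nat.one_le_pow _ _ hn) hn, ih, pow_succ]
  rw [Real.logb]
  set v := Real.log (g 2) with hv_def
  set w := Real.log (g a) with hw_def
  set A := Real.log (a : ℝ) with hA_def
  set L := Real.log (2 : ℝ) with hL_def
  have hL : 0 < L := Real.log_pos one_lt_two
  have hv : 0 ≤ v := Real.log_nonneg (hge (by norm_num))
  have ha0 : a ≠ 0 := by omega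
  have hapos : (0 : ℝ) < a := by exact_mod_cast Nat.pos_of_ne_zero ha0
  have hg2 : 0 < g 2 := lt_of_lt_of_le one_pos (hge (by norm_num))
  have hga : 0 < g a := lt_of_lt_of_le one_pos (hge ha)
  -- the comparison `2^b ≤ a^c < 2^(b+1)` for every `c ≥ 1`
  have key : ∀ c : ℕ, 1 ≤ c → (c * A / L - 1) * v ≤ c * w := by
    intro c hc
    set b := Nat.log 2 (a ^ c) with hb_def
    have hac : a ^ c ≠ 0 := pow_ne_zero c ha0
    have h2b : 2 ^ b ≤ a ^ c := Nat.pow_log_le_self 2 hac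
    have hlt : a ^ c < 2 ^ (b + 1) := Nat.lt_pow_succ_log_self one_lt_two _
    have hg : g 2 ^ b ≤ g a ^ c := by
      rw [← hpow (by norm_num) b, ← hpow ha c]
      exact hmono Nat.one_le_two_pow h2b
    have hlog1 : (b : ℝ) * v ≤ c * w := by
      have := Real.log_le_log (pow_pos hg2 b) hg
      rwa [Real.log_pow, Real.log_pow] at this
    have hlog2 : (c : ℝ) * A < ((b : ℝ) + 1) * L := by
      have h' : ((a : ℝ)) ^ c < (2 : ℝ) ^ (b + 1) := by exact_mod_cast hlt
      have := Real.log_lt_log (pow_pos hapos c) h'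
      rw [Real.log_pow, Real.log_pow] at this
      push_cast at this
      exact this
    have hb' : c * A / L - 1 ≤ b := by
      rw [sub_le_iff_le_add, div_le_iff₀ hL]
      linarith
    calc (c * A / L - 1) * v ≤ b * v := mul_le_mul_of_nonneg_right hb' hv
      _ ≤ c * w := hlog1
  -- divide by `c` and let `c → ∞`
  have main : ∀ c : ℕ, 1 ≤ c → v / L * A - v / c ≤ w := by
    intro c hc
    have hc' : (0 : ℝ) < c := by exact_mod_cast hc
    have h := key c hc
    have h' : (c * A / L - 1) * v / c ≤ w := by
      rw [div_le_iff₀ hc']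
      linarith
    calc v / L * A - v / c = (c * A / L - 1) * v / c := by
          field_simp
      _ ≤ w := h'
  refine le_of_forall_pos_lt_add fun δ hδ => ?_
  obtain ⟨c, hc⟩ := exists_nat_gt (v / δ)
  have hc1 : 1 ≤ c + 1 := Nat.le_add_left 1 c
  have hcpos : (0 : ℝ) < ((c + 1 : ℕ) : ℝ) := by positivity
  have h1' := main (c + 1) hc1
  have hsmall : v / ((c + 1 : ℕ) : ℝ) < δ := by
    rw [div_lt_iff₀ hcpos]
    have hvc : v < c * δ := by rwa [div_lt_iff₀ hδ] at hc
    push_cast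
    nlinarith
  linarith

end PowerLaw

/-! ## The technique class: `T`-methods (CLLZ Def. 3.9, Def. 3.12, Thm. 3.22) -/

section TMethod

variable (K : Type u) [Field K]

/-- **A reduction of a `T`-method** (CLLZ Def. 3.9): `T^{⊗k} ≥ ⟨n, n, m⟩^{⊕s}`, with `≥` the
restriction preorder `TensorRestrictsTo` and the `s`-fold direct sum written as `⟨s⟩ ⊗ ⟨n,n,m⟩`
(as CLLZ do after Thm. 2.1: `⟨s⟩^{⊗k} ⊗ ⟨n,n,m⟩^{⊗k} ≤ ⟨r⟩^{⊗k+o(k)}`); `⟨n,n,m⟩ = matMulTensor K n n m`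
("`n × n` times `n × m`"). [cite: ChristandlLeGallLysikovZuiddam2025, Def. 3.9] -/
def IsTMethodReduction {ι κ μ : Type} [Fintype ι] [Fintype κ] [Fintype μ] (T : ι → κ → μ → K)
    (k n m s : ℕ) : Prop :=
  Literature.Computability.AlgebraicComplexity.TensorRestrictsTo (Literature.Computability.AlgebraicComplexity.kroneckerPow T k) (Literature.Computability.AlgebraicComplexity.kroneckerTensor (Literature.Computability.AlgebraicComplexity.unitTensor K s) (Literature.Computability.AlgebraicComplexity.matMulTensor K n n m))

/-- **The bound of a reduction** `k log_n r − log_n s = (k log r − log s) / log n` (CLLZ Def. 3.9: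
with `R̃(T) ≤ r`, Thm. 2.1 turns `T^{⊗k} ≥ ⟨n,n,m⟩^{⊕s}`, `m ≥ n^p`, into `ω(p) ≤ k log_n r − log_n s`).
[cite: ChristandlLeGallLysikovZuiddam2025, Def. 3.9] -/
def tMethodBound (r : ℝ) (k n s : ℕ) : ℝ :=
  (k * Real.log r - Real.log s) / Real.log n

/-- **Upper bounds on `ω(p)` obtained by a `T`-method** (CLLZ Def. 3.9, and the asymptotic
`T`-methods of Def. 3.12), as the class of reals `ω̂` for which there is `r ≥ R̃(T)` such that for
every `ε > 0` some reduction `T^{⊗k} ≥ ⟨s⟩ ⊗ ⟨n,n,m⟩` with `n ≥ 2`, `s ≥ 1`, `m ≥ n^{p−ε}` has bound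
`k log_n r − log_n s ≤ ω̂ + ε`. This contains the bound `ω̂(p) = inf {k log_n r − log_n s}` of every
collection of reductions with `m ≥ n^p` (Def. 3.9) and the `lim inf` bound of every asymptotic
`T`-method (`n` unbounded, `m ≥ f(n) = n^{p+o(1)}`, Def. 3.12). [cite: ChristandlLeGallLysikovZuiddam2025, Def. 3.9 and Def. 3.12] -/
def IsTMethodBound {ι κ μ : Type} [Fintype ι] [Fintype κ] [Fintype μ] (T : ι → κ → μ → K)
    (p ω : ℝ) : Prop :=
  ∃ r : ℝ, Literature.Computability.AlgebraicComplexity.asymptoticRank T ≤ r ∧ ∀ ε : ℝ, 0 < ε → ∃ k n m s : ℕ, 2 ≤ n ∧ 1 ≤ s ∧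
    (n : ℝ) ^ (p - ε) ≤ m ∧ IsTMethodReduction K T k n m s ∧ tMethodBound r k n s ≤ ω + ε

/-- **"An asymptotic `T`-method proves that `p` is a lower bound on `α`"** (CLLZ Thm. 3.22 and its
proof: "then it can prove the upper bound `ω(p) ≤ 2`"): the `T`-method yields the upper bound `2` on
`ω(p)`. [cite: ChristandlLeGallLysikovZuiddam2025, Thm. 3.22] -/
def IsTMethodAlphaBound {ι κ μ : Type} [Fintype ι] [Fintype κ] [Fintype μ] (T : ι → κ → μ → K)
    (p : ℝ) : Prop :=
  IsTMethodBound K T p 2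

variable {K}

/-- A single reduction with `m ≥ n^p` yields the `T`-method bound `k log_n r − log_n s` (Def. 3.9
with a one-element collection). [cite: ChristandlLeGallLysikovZuiddam2025, Def. 3.9] -/
theorem IsTMethodReduction.isTMethodBound {ι κ μ : Type} [Fintype ι] [Fintype κ] [Fintype μ]
    {T : ι → κ → μ → K} {k n m s : ℕ} (h : IsTMethodReduction K T k n m s) {r p : ℝ}
    (hr : Literature.Computability.AlgebraicComplexity.asymptoticRank T ≤ r) (hn : 2 ≤ n) (hs : 1 ≤ s) (hm : (n : ℝ) ^ p ≤ m) :
    IsTMethodBound K T p (tMethodBound r k n s) := by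
  refine ⟨r, hr, fun ε hε => ⟨k, n, m, s, hn, hs, ?_, h, by linarith⟩⟩
  have hn' : (1 : ℝ) ≤ n := by exact_mod_cast (by omega : 1 ≤ n)
  exact (Real.rpow_le_rpow_of_exponent_le hn' (by linarith)).trans hm

/-- The class is upward closed in `ω̂` (a weaker bound is still a bound of the method).
[cite: ChristandlLeGallLysikovZuiddam2025, Def. 3.9] -/
theorem IsTMethodBound.mono {ι κ μ : Type} [Fintype ι] [Fintype κ] [Fintype μ]
    {T : ι → κ → μ → K} {p ω ω' : ℝ} (h : IsTMethodBound K T p ω) (hω : ω ≤ ω') :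
    IsTMethodBound K T p ω' := by
  obtain ⟨r, hr, H⟩ := h
  refine ⟨r, hr, fun ε hε => ?_⟩
  obtain ⟨k, n, m, s, hn, hs, hm, hred, hb⟩ := H ε hε
  exact ⟨k, n, m, s, hn, hs, hm, hred, hb.trans (by linarith)⟩

/-- The infimum of a nonempty collection of `T`-method bounds (one `r`) is a `T`-method bound — CLLZ's
`ω̂(p) = inf {k log_n r − log_n s}` over a collection of reductions (Def. 3.9). [cite: ChristandlLeGallLysikovZuiddam2025, Def. 3.9] -/
theorem IsTMethodBound.sInf {ι κ μ : Type} [Fintype ι] [Fintype κ] [Fintype μ]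
    {T : ι → κ → μ → K} {p r : ℝ} (hr : Literature.Computability.AlgebraicComplexity.asymptoticRank T ≤ r) {S : Set ℝ} (hS : S.Nonempty)
    (h : ∀ ω ∈ S, ∃ k n m s : ℕ, 2 ≤ n ∧ 1 ≤ s ∧ (n : ℝ) ^ p ≤ m ∧ IsTMethodReduction K T k n m s ∧
      tMethodBound r k n s = ω) :
    IsTMethodBound K T p (sInf S) := by
  refine ⟨r, hr, fun ε hε => ?_⟩
  obtain ⟨ω, hωS, hω⟩ := Real.lt_sInf_add_pos hS hε
  obtain ⟨k, n, m, s, hn, hs, hm, hred, hb⟩ := h ω hωS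
  have hn' : (1 : ℝ) ≤ n := by exact_mod_cast (by omega : 1 ≤ n)
  exact ⟨k, n, m, s, hn, hs, (Real.rpow_le_rpow_of_exponent_le hn' (by linarith)).trans hm, hred,
    by rw [hb]; exact hω.le⟩

end TMethod

/-! ## The certificates: adequate tensor parameters (CLLZ Def. 3.1) -/

section Adequate

variable (K : Type u) [Field K]

/-- **Adequate tensor parameter** (CLLZ Def. 3.1): a map `F : {tensors over K} → ℝ≥0` which is
(i) `≤`-monotone (`S ≤ T ⇒ F(S) ≤ F(T)`, restriction), (ii) `⊗`-submultiplicative, (iii)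
MaMu-`⊗`-multiplicative `F(⟨ℓ₁ℓ₂, m₁m₂, n₁n₂⟩) = F(⟨ℓ₁,m₁,n₁⟩) · F(⟨ℓ₂,m₂,n₂⟩)` (required for positive
formats), (iv) self-`⊕`-additive `F(T^{⊕s}) = s · F(T)` (`s ≥ 1`, with `T^{⊕s}` encoded as `⟨s⟩ ⊗ T`),
(v) bounded by the asymptotic rank, `F(T) ≤ R̃(T)`. A `SpectralMap` (`AsymptoticSpectrum.lean`) constrained on finite
formats with index types in `Type`. [cite: ChristandlLeGallLysikovZuiddam2025, Def. 3.1] -/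
structure IsAdequate (F : Literature.Computability.AlgebraicComplexity.SpectralMap K) : Prop where
  /-- Values are nonnegative (`F : {tensors} → ℝ≥0`). -/
  nonneg : ∀ {ι κ μ : Type} [Fintype ι] [Fintype κ] [Fintype μ] (t : ι → κ → μ → K), 0 ≤ F t
  /-- (i) Monotone under restriction: `t ≥ s → F s ≤ F t`. -/
  mono : ∀ {ι κ μ ι' κ' μ' : Type} [Fintype ι] [Fintype κ] [Fintype μ] [Fintype ι']
    [Fintype κ'] [Fintype μ'] (t : ι → κ → μ → K) (s : ι' → κ' → μ' → K),
    Literature.Computability.AlgebraicComplexity.TensorRestrictsTo t s → F s ≤ F t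
  /-- (ii) Submultiplicative under the Kronecker product. -/
  submultiplicative : ∀ {ι κ μ ι' κ' μ' : Type} [Fintype ι] [Fintype κ] [Fintype μ] [Fintype ι']
    [Fintype κ'] [Fintype μ'] (s : ι → κ → μ → K) (t : ι' → κ' → μ' → K),
    F (Literature.Computability.AlgebraicComplexity.kroneckerTensor s t) ≤ F s * F t
  /-- (iii) MaMu-`⊗`-multiplicative: `F(⟨ℓ₁ℓ₂, m₁m₂, n₁n₂⟩) = F(⟨ℓ₁,m₁,n₁⟩) · F(⟨ℓ₂,m₂,n₂⟩)` for
  positive formats. -/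
  mamu : ∀ l₁ l₂ m₁ m₂ n₁ n₂ : ℕ, 1 ≤ l₁ → 1 ≤ l₂ → 1 ≤ m₁ → 1 ≤ m₂ → 1 ≤ n₁ → 1 ≤ n₂ →
    F (Literature.Computability.AlgebraicComplexity.matMulTensor K (l₁ * l₂) (m₁ * m₂) (n₁ * n₂)) =
      F (Literature.Computability.AlgebraicComplexity.matMulTensor K l₁ m₁ n₁) * F (Literature.Computability.AlgebraicComplexity.matMulTensor K l₂ m₂ n₂)
  /-- (iv) Self-`⊕`-additive: `F(T^{⊕s}) = s · F(T)` for `s ≥ 1`, the `s`-fold direct sum being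
  `⟨s⟩ ⊗ T`. -/
  selfAdditive : ∀ {ι κ μ : Type} [Fintype ι] [Fintype κ] [Fintype μ] (s : ℕ), 1 ≤ s →
    ∀ t : ι → κ → μ → K, F (Literature.Computability.AlgebraicComplexity.kroneckerTensor (Literature.Computability.AlgebraicComplexity.unitTensor K s) t) = s * F t
  /-- (v) At most the asymptotic rank. -/
  le_asymptoticRank : ∀ {ι κ μ : Type} [Fintype ι] [Fintype κ] [Fintype μ] (t : ι → κ → μ → K),
    F t ≤ Literature.Computability.AlgebraicComplexity.asymptoticRank t

variable {K}

/-- The asymptotic rank of the empty power `t^{⊗0}` (the scalar `1`) is at most `1`. [folklore] -/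
theorem asymptoticRank_kroneckerPow_zero_le {ι κ μ : Type} [Fintype ι] [Fintype κ] [Fintype μ]
    (t : ι → κ → μ → K) : Literature.Computability.AlgebraicComplexity.asymptoticRank (Literature.Computability.AlgebraicComplexity.kroneckerPow t 0) ≤ 1 := by
  refine (Literature.Computability.AlgebraicComplexity.asymptoticRank_le_tensorRank_pow_one _).trans ?_
  have h1 : Literature.Computability.AlgebraicComplexity.tensorRank (Literature.Computability.AlgebraicComplexity.kroneckerPow (Literature.Computability.AlgebraicComplexity.kroneckerPow t 0) 1) ≤ 1 := by
    refine Literature.Computability.AlgebraicComplexity.tensorRank_le_of_eq_sum (fun _ _ => 1) (fun _ _ => 1) (fun _ _ => 1) ?_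
    funext a b c
    simp [Literature.Computability.AlgebraicComplexity.kroneckerPow, Literature.Computability.AlgebraicComplexity.triad, Finset.sum_apply]
  exact_mod_cast h1

namespace IsAdequate

variable {F : Literature.Computability.AlgebraicComplexity.SpectralMap K} (hF : IsAdequate K F)
include hF

/-- (iv) as an inequality: `F(⟨s⟩ ⊗ u) ≥ s · F(u)` (CLLZ proof of Thm. 3.10: "superadditivity of `F`:
`F(⟨n,n,m⟩^{⊕s}) ≥ s F(⟨n,n,m⟩)`"; for `s = 0` by nonnegativity). [cite: ChristandlLeGallLysikovZuiddam2025, Thm. 3.10 (proof)] -/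
theorem mul_le_map_unit_kronecker {ι κ μ : Type} [Fintype ι] [Fintype κ] [Fintype μ]
    (u : ι → κ → μ → K) (s : ℕ) : (s : ℝ) * F u ≤ F (Literature.Computability.AlgebraicComplexity.kroneckerTensor (Literature.Computability.AlgebraicComplexity.unitTensor K s) u) := by
  rcases Nat.eq_zero_or_pos s with rfl | hs
  · simpa using hF.nonneg (Literature.Computability.AlgebraicComplexity.kroneckerTensor (Literature.Computability.AlgebraicComplexity.unitTensor K 0) u)
  · exact (hF.selfAdditive s hs u).ge

/-- Submultiplicativity iterated: `F(T^{⊗k}) ≤ F(T)^k` (CLLZ proof of Thm. 3.10: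
`k log_n F(T) ≥ log_n F(T^{⊗k})`; the case `k = 0` uses (v): `F(T^{⊗0}) ≤ R̃(T^{⊗0}) ≤ 1`).
[cite: ChristandlLeGallLysikovZuiddam2025, Thm. 3.10 (proof)] -/
theorem map_kroneckerPow_le {ι κ μ : Type} [Fintype ι] [Fintype κ] [Fintype μ]
    (T : ι → κ → μ → K) (k : ℕ) : F (Literature.Computability.AlgebraicComplexity.kroneckerPow T k) ≤ F T ^ k := by
  induction k with
  | zero =>
    simpa using (hF.le_asymptoticRank (Literature.Computability.AlgebraicComplexity.kroneckerPow T 0)).trans (asymptoticRank_kroneckerPow_zero_le T)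
  | succ k ih =>
    calc F (Literature.Computability.AlgebraicComplexity.kroneckerPow T (k + 1)) ≤ F (Literature.Computability.AlgebraicComplexity.kroneckerTensor (Literature.Computability.AlgebraicComplexity.kroneckerPow T k) T) :=
          hF.mono _ _ (tensorRestrictsTo_kroneckerPow_succ T k)
      _ ≤ F (Literature.Computability.AlgebraicComplexity.kroneckerPow T k) * F T := hF.submultiplicative _ _
      _ ≤ F T ^ k * F T := mul_le_mul_of_nonneg_right ih (hF.nonneg T)
      _ = F T ^ (k + 1) := by ring

/-- Monotonicity in the format: `F(⟨k,m,n⟩) ≤ F(⟨k',m',n'⟩)` for `k ≤ k'`, `m ≤ m'`, `n ≤ n'`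
((i) with zero-padding; CLLZ proof of Lemma 3.2). [cite: ChristandlLeGallLysikovZuiddam2025, Lemma 3.2 (proof)] -/
theorem map_matMul_mono {k k' m m' n n' : ℕ} (hk : k ≤ k') (hm : m ≤ m') (hn : n ≤ n') :
    F (Literature.Computability.AlgebraicComplexity.matMulTensor K k m n) ≤ F (Literature.Computability.AlgebraicComplexity.matMulTensor K k' m' n') :=
  hF.mono _ _ (tensorRestrictsTo_matMulTensor_of_le K hk hm hn)

/-- `F(⟨1,1,1⟩) = 1` as soon as `F` does not vanish at some tensor `T` ((i), (ii): `F(T) ≤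
F(⟨1,1,1⟩ ⊗ T) ≤ F(⟨1,1,1⟩) F(T)`, so `F(⟨1,1,1⟩) ≥ 1`; (iii): `F(⟨1,1,1⟩) = F(⟨1,1,1⟩)²`).
[cite: ChristandlLeGallLysikovZuiddam2025, Def. 3.1] -/
theorem map_matMul_one {ι κ μ : Type} [Fintype ι] [Fintype κ] [Fintype μ] {T : ι → κ → μ → K}
    (hT : 0 < F T) : F (Literature.Computability.AlgebraicComplexity.matMulTensor K 1 1 1) = 1 := by
  have h1 : F T ≤ F (Literature.Computability.AlgebraicComplexity.matMulTensor K 1 1 1) * F T :=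
    (hF.mono _ _ (tensorRestrictsTo_matMulOne_kronecker T)).trans (hF.submultiplicative _ _)
  have hge : 1 ≤ F (Literature.Computability.AlgebraicComplexity.matMulTensor K 1 1 1) := by
    by_contra h
    have h' : F (Literature.Computability.AlgebraicComplexity.matMulTensor K 1 1 1) < 1 := lt_of_not_ge h
    have : F (Literature.Computability.AlgebraicComplexity.matMulTensor K 1 1 1) * F T < 1 * F T := mul_lt_mul_of_pos_right h' hT
    linarith
  have hsq : F (Literature.Computability.AlgebraicComplexity.matMulTensor K 1 1 1) = F (Literature.Computability.AlgebraicComplexity.matMulTensor K 1 1 1) * F (Literature.Computability.AlgebraicComplexity.matMulTensor K 1 1 1) := by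
    have h := hF.mamu 1 1 1 1 1 1 le_rfl le_rfl le_rfl le_rfl le_rfl le_rfl
    rwa [Literature.Computability.AlgebraicComplexity.SpectralMap.map_matMulTensor_congr F (Nat.mul_one 1) (Nat.mul_one 1) (Nat.mul_one 1)] at h
  nlinarith

/-- `F(⟨k,m,n⟩) ≥ 1` for positive formats once `F(⟨1,1,1⟩) = 1` (monotonicity).
[cite: ChristandlLeGallLysikovZuiddam2025, Def. 3.1] -/
theorem one_le_map_matMul (h1 : F (Literature.Computability.AlgebraicComplexity.matMulTensor K 1 1 1) = 1) {k m n : ℕ} (hk : 1 ≤ k)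
    (hm : 1 ≤ m) (hn : 1 ≤ n) : 1 ≤ F (Literature.Computability.AlgebraicComplexity.matMulTensor K k m n) :=
  h1 ▸ hF.map_matMul_mono hk hm hn

/-- (iii) unbundled: `F(⟨k,m,n⟩) = F(⟨k,1,1⟩) F(⟨1,m,1⟩) F(⟨1,1,n⟩)` for positive formats (CLLZ proof
of Lemma 3.7/3.8). [cite: ChristandlLeGallLysikovZuiddam2025, Lemma 3.8 (proof)] -/
theorem map_matMul_eq_mul₃ {k m n : ℕ} (hk : 1 ≤ k) (hm : 1 ≤ m) (hn : 1 ≤ n) :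
    F (Literature.Computability.AlgebraicComplexity.matMulTensor K k m n) =
      F (Literature.Computability.AlgebraicComplexity.matMulTensor K k 1 1) * F (Literature.Computability.AlgebraicComplexity.matMulTensor K 1 m 1) * F (Literature.Computability.AlgebraicComplexity.matMulTensor K 1 1 n) := by
  have ha := hF.mamu k 1 m 1 1 n hk le_rfl hm le_rfl le_rfl hn
  rw [Literature.Computability.AlgebraicComplexity.SpectralMap.map_matMulTensor_congr F (Nat.mul_one k) (Nat.mul_one m) (Nat.one_mul n)] at ha
  have hb := hF.mamu k 1 1 m 1 1 hk le_rfl le_rfl hm le_rfl le_rfl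
  rw [Literature.Computability.AlgebraicComplexity.SpectralMap.map_matMulTensor_congr F (Nat.mul_one k) (Nat.one_mul m) (Nat.mul_one 1)] at hb
  rw [ha, hb]

/-- **Half of CLLZ Lemma 3.7 (with Lemma 3.4/3.8), for every adequate `F` with `F(⟨1,1,1⟩) = 1`:**
`log F(⟨n,n,m⟩) ≥ (log₂ F(⟨2,1,1⟩) + log₂ F(⟨1,2,1⟩)) · log n + log₂ F(⟨1,1,2⟩) · log m` for `n, m ≥ 1`
— i.e. `log_n F(⟨n,n,m⟩) ≥ log₂ F(⟨2,2,2^p⟩)` when `m ≥ n^p`, with the virtual value evaluated by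
Lemma 3.7. [cite: ChristandlLeGallLysikovZuiddam2025, Lemma 3.7] -/
theorem log_map_matMul_ge (h1 : F (Literature.Computability.AlgebraicComplexity.matMulTensor K 1 1 1) = 1) {n m : ℕ} (hn : 1 ≤ n) (hm : 1 ≤ m) :
    (Real.logb 2 (F (Literature.Computability.AlgebraicComplexity.matMulTensor K 2 1 1)) + Real.logb 2 (F (Literature.Computability.AlgebraicComplexity.matMulTensor K 1 2 1))) * Real.log n +
        Real.logb 2 (F (Literature.Computability.AlgebraicComplexity.matMulTensor K 1 1 2)) * Real.log m ≤
      Real.log (F (Literature.Computability.AlgebraicComplexity.matMulTensor K n n m)) := by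
  -- the three one-parameter families
  have g₁ := logb_two_mul_log_le_log (g := fun a => F (Literature.Computability.AlgebraicComplexity.matMulTensor K a 1 1)) h1
    (fun a b ha hab => hF.map_matMul_mono hab le_rfl le_rfl)
    (fun a b ha hb => by
      have h := hF.mamu a b 1 1 1 1 ha hb le_rfl le_rfl le_rfl le_rfl
      rwa [Literature.Computability.AlgebraicComplexity.SpectralMap.map_matMulTensor_congr F rfl (Nat.mul_one 1) (Nat.mul_one 1)] at h) hn
  have g₂ := logb_two_mul_log_le_log (g := fun a => F (Literature.Computability.AlgebraicComplexity.matMulTensor K 1 a 1)) h1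
    (fun a b ha hab => hF.map_matMul_mono le_rfl hab le_rfl)
    (fun a b ha hb => by
      have h := hF.mamu 1 1 a b 1 1 le_rfl le_rfl ha hb le_rfl le_rfl
      rwa [Literature.Computability.AlgebraicComplexity.SpectralMap.map_matMulTensor_congr F (Nat.mul_one 1) rfl (Nat.mul_one 1)] at h) hn
  have g₃ := logb_two_mul_log_le_log (g := fun a => F (Literature.Computability.AlgebraicComplexity.matMulTensor K 1 1 a)) h1
    (fun a b ha hab => hF.map_matMul_mono le_rfl le_rfl hab)
    (fun a b ha hb => by
      have h := hF.mamu 1 1 1 1 a b le_rfl le_rfl le_rfl le_rfl ha hb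
      rwa [Literature.Computability.AlgebraicComplexity.SpectralMap.map_matMulTensor_congr F (Nat.mul_one 1) (Nat.mul_one 1) rfl] at h) hm
  beta_reduce at g₁ g₂ g₃
  have p₁ : 0 < F (Literature.Computability.AlgebraicComplexity.matMulTensor K n 1 1) := lt_of_lt_of_le one_pos (hF.one_le_map_matMul h1 hn le_rfl le_rfl)
  have p₂ : 0 < F (Literature.Computability.AlgebraicComplexity.matMulTensor K 1 n 1) := lt_of_lt_of_le one_pos (hF.one_le_map_matMul h1 le_rfl hn le_rfl)
  have p₃ : 0 < F (Literature.Computability.AlgebraicComplexity.matMulTensor K 1 1 m) := lt_of_lt_of_le one_pos (hF.one_le_map_matMul h1 le_rfl le_rfl hm)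
  rw [hF.map_matMul_eq_mul₃ hn hn hm, Real.log_mul (mul_pos p₁ p₂).ne' p₃.ne',
    Real.log_mul p₁.ne' p₂.ne']
  linarith

/-- **CLLZ Theorem 3.10, one reduction, format form** (the displayed inequality
`(ω̂_{k,s,n,m} + log_n s)/(log_n F(⟨n,n,m⟩) + log_n s) ≥ log R̃(T)/log F(T)` of the proofs of Thm. 3.10
and Thm. 3.15, cleared of denominators and with `R̃(T) ≤ r`): if `T^{⊗k} ≥ ⟨s⟩ ⊗ ⟨n,n,m⟩` (`n ≥ 2`,
`s ≥ 1`), `F(T) > 1` and `F(⟨n,n,m⟩) > 0`, then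
`k log_n r − log_n s ≥ (log r / log F(T)) · log_n F(⟨n,n,m⟩) + (log r / log F(T) − 1) · log_n s`.
The second term is the catalyticity gain (`≥ 0`). Uses (i), (ii), (iv), (v).
[cite: ChristandlLeGallLysikovZuiddam2025, Thm. 3.10] -/
theorem le_tMethodBound {ι κ μ : Type} [Fintype ι] [Fintype κ] [Fintype μ] {T : ι → κ → μ → K}
    {r : ℝ} (hr : Literature.Computability.AlgebraicComplexity.asymptoticRank T ≤ r) (hT : 1 < F T) {k n m s : ℕ} (hn : 2 ≤ n) (hs : 1 ≤ s)
    (hred : IsTMethodReduction K T k n m s) (hpos : 0 < F (Literature.Computability.AlgebraicComplexity.matMulTensor K n n m)) :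
    Real.log r / Real.log (F T) * (Real.log (F (Literature.Computability.AlgebraicComplexity.matMulTensor K n n m)) / Real.log n) +
        (Real.log r / Real.log (F T) - 1) * (Real.log s / Real.log n) ≤
      tMethodBound r k n s := by
  set f := Real.log (F T) with hf
  set R := Real.log r with hR
  set M := Real.log (F (Literature.Computability.AlgebraicComplexity.matMulTensor K n n m)) with hM
  set S := Real.log (s : ℝ) with hS
  set L := Real.log (n : ℝ) with hL
  have hFr : F T ≤ r := (hF.le_asymptoticRank T).trans hr
  have hf0 : 0 < f := Real.log_pos hT
  have hfR : f ≤ R := Real.log_le_log (by linarith) hFr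
  have hR0 : 0 < R := hf0.trans_le hfR
  have hL0 : 0 < L := Real.log_pos (by exact_mod_cast (by omega : 1 < n))
  have key : (s : ℝ) * F (Literature.Computability.AlgebraicComplexity.matMulTensor K n n m) ≤ F T ^ k :=
    calc (s : ℝ) * F (Literature.Computability.AlgebraicComplexity.matMulTensor K n n m)
        ≤ F (Literature.Computability.AlgebraicComplexity.kroneckerTensor (Literature.Computability.AlgebraicComplexity.unitTensor K s) (Literature.Computability.AlgebraicComplexity.matMulTensor K n n m)) :=
          hF.mul_le_map_unit_kronecker _ _
      _ ≤ F (Literature.Computability.AlgebraicComplexity.kroneckerPow T k) := hF.mono _ _ hred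
      _ ≤ F T ^ k := hF.map_kroneckerPow_le T k
  have hs0 : (0 : ℝ) < s := by exact_mod_cast (by omega : 0 < s)
  have hMS : S + M ≤ k * f := by
    have h1 : Real.log ((s : ℝ) * F (Literature.Computability.AlgebraicComplexity.matMulTensor K n n m)) ≤ Real.log (F T ^ k) :=
      Real.log_le_log (mul_pos hs0 hpos) key
    rw [Real.log_mul hs0.ne' hpos.ne', Real.log_pow] at h1
    exact h1
  have hρ : 0 ≤ R / f := div_nonneg hR0.le hf0.le
  have h2 : R / f * (S + M) ≤ k * R := by
    calc R / f * (S + M) ≤ R / f * (k * f) := mul_le_mul_of_nonneg_left hMS hρ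
      _ = k * R := by field_simp
  have h3 : R / f * M + (R / f - 1) * S ≤ k * R - S := by nlinarith
  calc R / f * (M / L) + (R / f - 1) * (S / L) = (R / f * M + (R / f - 1) * S) / L := by ring
    _ ≤ (k * R - S) / L := div_le_div_of_nonneg_right h3 hL0.le
    _ = tMethodBound r k n s := by simp [tMethodBound, hR, hS, hL]

/-- The barrier from a lower bound `log F(⟨n,n,m⟩) ≥ e · log n + e₃ · log m` on matrix multiplication
tensors (`e₃ ≥ 0`, `F(⟨n,n,m⟩) ≥ 1`): every `T`-method bound `ω̂` on `ω(p)` (`F(T) > 1`) satisfies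
`ω̂ ≥ (e + p e₃) log R̃(T) / log F(T)`. The proofs of Thm. 3.10/3.15, with `ε → 0` along `m ≥ n^{p−ε}`.
[cite: ChristandlLeGallLysikovZuiddam2025, Thm. 3.15 (proof)] -/
theorem barrier_of_le_log {e e₃ : ℝ} (he₃ : 0 ≤ e₃)
    (hone : ∀ n m : ℕ, 1 ≤ n → 1 ≤ m → 1 ≤ F (Literature.Computability.AlgebraicComplexity.matMulTensor K n n m))
    (hlow : ∀ n m : ℕ, 1 ≤ n → 1 ≤ m →
      e * Real.log n + e₃ * Real.log m ≤ Real.log (F (Literature.Computability.AlgebraicComplexity.matMulTensor K n n m)))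
    {ι κ μ : Type} [Fintype ι] [Fintype κ] [Fintype μ] {T : ι → κ → μ → K} (hT : 1 < F T)
    {p ω : ℝ} (h : IsTMethodBound K T p ω) :
    Real.log (Literature.Computability.AlgebraicComplexity.asymptoticRank T) / Real.log (F T) * (e + p * e₃) ≤ ω := by
  obtain ⟨r, hr, H⟩ := h
  set f := Real.log (F T) with hf
  have hf0 : 0 < f := Real.log_pos hT
  have hRT : F T ≤ Literature.Computability.AlgebraicComplexity.asymptoticRank T := hF.le_asymptoticRank T
  set ρ := Real.log (Literature.Computability.AlgebraicComplexity.asymptoticRank T) / f with hρdef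
  have hρ0 : 0 ≤ ρ := div_nonneg (Real.log_nonneg (hT.le.trans hRT)) hf0.le
  have hρr : ρ ≤ Real.log r / f :=
    div_le_div_of_nonneg_right (Real.log_le_log (by linarith) hr) hf0.le
  have main : ∀ ε : ℝ, 0 < ε → ρ * (e + (p - ε) * e₃) ≤ ω + ε := by
    intro ε hε
    obtain ⟨k, n, m, s, hn, hs, hm, hred, hb⟩ := H ε hε
    have hn1 : (1 : ℝ) < n := by exact_mod_cast (by omega : 1 < n)
    have hL0 : 0 < Real.log n := Real.log_pos hn1
    have hnp : 0 < (n : ℝ) ^ (p - ε) := Real.rpow_pos_of_pos (by linarith) _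
    have hm0 : (0 : ℝ) < m := hnp.trans_le hm
    have hm1 : 1 ≤ m := by exact_mod_cast (show (0 : ℝ) < m from hm0)
    have h1le : 1 ≤ F (Literature.Computability.AlgebraicComplexity.matMulTensor K n n m) := hone n m (by omega) hm1
    have hpos : 0 < F (Literature.Computability.AlgebraicComplexity.matMulTensor K n n m) := lt_of_lt_of_le one_pos h1le
    have hA := hF.le_tMethodBound hr hT hn hs hred hpos
    have hlogm : (p - ε) * Real.log n ≤ Real.log m := by
      have := Real.log_le_log hnp hm
      rwa [Real.log_rpow (by linarith)] at this
    have hM : (e + (p - ε) * e₃) * Real.log n ≤ Real.log (F (Literature.Computability.AlgebraicComplexity.matMulTensor K n n m)) := by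
      have h' := hlow n m (by omega) hm1
      have h'' : e₃ * ((p - ε) * Real.log n) ≤ e₃ * Real.log m := mul_le_mul_of_nonneg_left hlogm he₃
      nlinarith
    have hM' : e + (p - ε) * e₃ ≤ Real.log (F (Literature.Computability.AlgebraicComplexity.matMulTensor K n n m)) / Real.log n := by
      rw [le_div_iff₀ hL0]; exact hM
    have hcat : 0 ≤ (Real.log r / f - 1) * (Real.log s / Real.log n) := by
      refine mul_nonneg ?_ (div_nonneg (Real.log_nonneg (by exact_mod_cast hs)) hL0.le)
      have : f ≤ Real.log r := Real.log_le_log (by linarith) (hRT.trans hr)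
      rw [sub_nonneg, le_div_iff₀ hf0]; linarith
    have hquot : 0 ≤ Real.log (F (Literature.Computability.AlgebraicComplexity.matMulTensor K n n m)) / Real.log n :=
      div_nonneg (Real.log_nonneg h1le) hL0.le
    calc ρ * (e + (p - ε) * e₃)
        ≤ ρ * (Real.log (F (Literature.Computability.AlgebraicComplexity.matMulTensor K n n m)) / Real.log n) :=
          mul_le_mul_of_nonneg_left hM' hρ0
      _ ≤ Real.log r / f * (Real.log (F (Literature.Computability.AlgebraicComplexity.matMulTensor K n n m)) / Real.log n) :=
          mul_le_mul_of_nonneg_right hρr hquot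
      _ ≤ tMethodBound r k n s := by linarith
      _ ≤ ω + ε := hb
  refine le_of_forall_pos_lt_add fun δ hδ => ?_
  have hc : 0 < 1 + ρ * e₃ := by positivity
  have hε : 0 < δ / (1 + ρ * e₃) / 2 := by positivity
  have := main _ hε
  have hsplit : ρ * (e + p * e₃) =
      ρ * (e + (p - δ / (1 + ρ * e₃) / 2) * e₃) + ρ * e₃ * (δ / (1 + ρ * e₃) / 2) := by ring
  rw [hsplit]
  have hbound : ρ * e₃ * (δ / (1 + ρ * e₃) / 2) + δ / (1 + ρ * e₃) / 2 = δ / 2 := by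
    field_simp
    ring
  nlinarith

/-- **CLLZ Theorem 1.1 = Theorem 3.15 (first part), with Lemma 3.7, for every adequate `F`:** every
upper bound `ω̂` on `ω(p)` obtained by a `T`-method (`F(T) > 1`) satisfies
`ω̂ ≥ log₂(F(⟨2,1,1⟩) F(⟨1,2,1⟩) F(⟨1,1,2⟩)^p) · log R̃(T) / log F(T)`
(`= log F(⟨2,2,2^p⟩) log R̃(T) / log F(T)`, Thm. 3.10/3.15, by Lemma 3.7).
[cite: ChristandlLeGallLysikovZuiddam2025, Thm. 1.1 and Thm. 3.15] -/
theorem barrier {ι κ μ : Type} [Fintype ι] [Fintype κ] [Fintype μ] {T : ι → κ → μ → K}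
    (hT : 1 < F T) {p ω : ℝ} (h : IsTMethodBound K T p ω) :
    Real.log (Literature.Computability.AlgebraicComplexity.asymptoticRank T) / Real.log (F T) *
        (Real.logb 2 (F (Literature.Computability.AlgebraicComplexity.matMulTensor K 2 1 1)) + Real.logb 2 (F (Literature.Computability.AlgebraicComplexity.matMulTensor K 1 2 1)) +
          p * Real.logb 2 (F (Literature.Computability.AlgebraicComplexity.matMulTensor K 1 1 2))) ≤ ω := by
  have h1 : F (Literature.Computability.AlgebraicComplexity.matMulTensor K 1 1 1) = 1 := hF.map_matMul_one (lt_trans one_pos hT)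
  have hb := hF.barrier_of_le_log
    (e := Real.logb 2 (F (Literature.Computability.AlgebraicComplexity.matMulTensor K 2 1 1)) + Real.logb 2 (F (Literature.Computability.AlgebraicComplexity.matMulTensor K 1 2 1)))
    (e₃ := Real.logb 2 (F (Literature.Computability.AlgebraicComplexity.matMulTensor K 1 1 2)))
    (Real.logb_nonneg one_lt_two (hF.one_le_map_matMul h1 le_rfl le_rfl (by norm_num)))
    (fun n m hn hm => hF.one_le_map_matMul h1 hn hn hm)
    (fun n m hn hm => hF.log_map_matMul_ge h1 hn hm) hT h
  simpa [add_assoc] using hb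

/-- **CLLZ Theorem 1.2 = Theorem 3.22 (barrier on the dual exponent), for every adequate `F` with
`log F(⟨1,1,2⟩) ≠ 0`:** for `0 < p < 1`, if an asymptotic `T`-method proves that `p` is a lower bound on
`α` (so proves `ω(p) ≤ 2`; `F(T) > 1`), then
`p ≤ 2 log F(T) / (log R̃(T) · log₂ F(⟨1,1,2⟩)) − log F(⟨2,2,1⟩) / log F(⟨1,1,2⟩)` (the printed
logarithms are `log₂`; the second term and `log F(T)/log R̃(T)` are base-free). The hypothesis
`0 < p < 1` is not needed for the inequality. [cite: ChristandlLeGallLysikovZuiddam2025, Thm. 3.22] -/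
theorem alpha_barrier {ι κ μ : Type} [Fintype ι] [Fintype κ] [Fintype μ] {T : ι → κ → μ → K}
    (hT : 1 < F T) (h3 : Real.log (F (Literature.Computability.AlgebraicComplexity.matMulTensor K 1 1 2)) ≠ 0) {p : ℝ}
    (h : IsTMethodAlphaBound K T p) :
    p ≤ 2 * Real.log (F T) / (Real.log (Literature.Computability.AlgebraicComplexity.asymptoticRank T) * Real.logb 2 (F (Literature.Computability.AlgebraicComplexity.matMulTensor K 1 1 2))) -
      Real.log (F (Literature.Computability.AlgebraicComplexity.matMulTensor K 2 2 1)) / Real.log (F (Literature.Computability.AlgebraicComplexity.matMulTensor K 1 1 2)) := by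
  have hB := hF.barrier hT h
  have h1 : F (Literature.Computability.AlgebraicComplexity.matMulTensor K 1 1 1) = 1 := hF.map_matMul_one (lt_trans one_pos hT)
  set f := Real.log (F T) with hf
  set R := Real.log (Literature.Computability.AlgebraicComplexity.asymptoticRank T) with hR
  set e₁ := Real.logb 2 (F (Literature.Computability.AlgebraicComplexity.matMulTensor K 2 1 1)) with he₁
  set e₂ := Real.logb 2 (F (Literature.Computability.AlgebraicComplexity.matMulTensor K 1 2 1)) with he₂
  set e₃ := Real.logb 2 (F (Literature.Computability.AlgebraicComplexity.matMulTensor K 1 1 2)) with he₃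
  have hf0 : 0 < f := Real.log_pos hT
  have hRT : F T ≤ Literature.Computability.AlgebraicComplexity.asymptoticRank T := hF.le_asymptoticRank T
  have hR0 : 0 < R := hf0.trans_le (Real.log_le_log (by linarith) hRT)
  have hL : 0 < Real.log (2 : ℝ) := Real.log_pos one_lt_two
  have h112 : 1 ≤ F (Literature.Computability.AlgebraicComplexity.matMulTensor K 1 1 2) := hF.one_le_map_matMul h1 le_rfl le_rfl (by norm_num)
  have h211 : 1 ≤ F (Literature.Computability.AlgebraicComplexity.matMulTensor K 2 1 1) := hF.one_le_map_matMul h1 (by norm_num) le_rfl le_rfl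
  have h121 : 1 ≤ F (Literature.Computability.AlgebraicComplexity.matMulTensor K 1 2 1) := hF.one_le_map_matMul h1 le_rfl (by norm_num) le_rfl
  have hlog112 : 0 < Real.log (F (Literature.Computability.AlgebraicComplexity.matMulTensor K 1 1 2)) :=
    lt_of_le_of_ne (Real.log_nonneg h112) (Ne.symm h3)
  have he₃0 : 0 < e₃ := div_pos hlog112 hL
  -- `log F(⟨2,2,1⟩) = log F(⟨2,1,1⟩) + log F(⟨1,2,1⟩)` by (iii)
  have h221 : Real.log (F (Literature.Computability.AlgebraicComplexity.matMulTensor K 2 2 1)) =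
      Real.log (F (Literature.Computability.AlgebraicComplexity.matMulTensor K 2 1 1)) + Real.log (F (Literature.Computability.AlgebraicComplexity.matMulTensor K 1 2 1)) := by
    have hm := hF.mamu 2 1 1 2 1 1 (by norm_num) le_rfl le_rfl (by norm_num) le_rfl le_rfl
    rw [Literature.Computability.AlgebraicComplexity.SpectralMap.map_matMulTensor_congr F (Nat.mul_one 2) (Nat.one_mul 2) (Nat.mul_one 1)] at hm
    rw [hm, Real.log_mul (by linarith) (by linarith)]
  -- from the barrier with `ω̂ = 2`
  have step1 : e₁ + e₂ + p * e₃ ≤ 2 * f / R := by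
    rw [le_div_iff₀ hR0]
    have hB' := hB
    rw [div_mul_eq_mul_div, div_le_iff₀ hf0] at hB'
    linarith
  have step2 : p ≤ (2 * f / R - (e₁ + e₂)) / e₃ := by
    rw [le_div_iff₀ he₃0]; linarith
  have hsum : e₁ + e₂ = Real.log (F (Literature.Computability.AlgebraicComplexity.matMulTensor K 2 2 1)) / Real.log 2 := by
    rw [he₁, he₂, Real.logb, Real.logb, h221, add_div]
  calc p ≤ (2 * f / R - (e₁ + e₂)) / e₃ := step2
    _ = 2 * f / (R * e₃) - (e₁ + e₂) / e₃ := by rw [sub_div, div_div]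
    _ = 2 * f / (R * e₃) -
          Real.log (F (Literature.Computability.AlgebraicComplexity.matMulTensor K 2 2 1)) / Real.log (F (Literature.Computability.AlgebraicComplexity.matMulTensor K 1 1 2)) := by
        rw [hsum, he₃, Real.logb, div_div_div_cancel_right₀ hL.ne']

end IsAdequate

end Adequate

/-! ## Strassen's upper support functionals are adequate (CLLZ Lemma 4.1, Lemma 4.2, eq. (5)) -/

section Support

variable (K : Type u) [Field K]

/-- **The upper support functional `ζ^θ` as a spectral map** on all 3-tensors over `K` with index
types in `Type`: on finite index types `ζ^θ(t) = upperSupportFunctional θ t` (CVZ 2023 Def. 2.3,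
`QuantumFunctionals.lean`), computed with the classical instances (any instances give the same value,
`upperSupportPoint_apply`); junk `0` on infinite index types (never constrained). CLLZ §4.1, eq. (4).
[cite: ChristandlLeGallLysikovZuiddam2025, §4.1 (eq. (4))] -/
def upperSupportPoint (θ : Fin 3 → ℝ) : Literature.Computability.AlgebraicComplexity.SpectralMap K :=
  fun ι κ μ t =>
    open Classical in
    if h : Finite ι ∧ Finite κ ∧ Finite μ then
      haveI := h.1
      haveI := h.2.1
      haveI := h.2.2
      letI := Fintype.ofFinite ι
      letI := Fintype.ofFinite κ
      letI := Fintype.ofFinite μ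
      Literature.Computability.AlgebraicComplexity.upperSupportFunctional θ t
    else 0

variable {K}

/-- Instance independence: on finite index types `upperSupportPoint K θ t = ζ^θ(t)` for every choice of
`Fintype`/`DecidableEq` instances. [folklore] -/
@[simp] theorem upperSupportPoint_apply {ι κ μ : Type} [Fintype ι] [Fintype κ] [Fintype μ]
    [DecidableEq ι] [DecidableEq κ] [DecidableEq μ] (θ : Fin 3 → ℝ) (t : ι → κ → μ → K) :
    upperSupportPoint K θ t = Literature.Computability.AlgebraicComplexity.upperSupportFunctional θ t := by
  have h : Finite ι ∧ Finite κ ∧ Finite μ :=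
    ⟨Finite.of_fintype ι, Finite.of_fintype κ, Finite.of_fintype μ⟩
  unfold upperSupportPoint
  rw [dif_pos h]
  congr!

/-- **CLLZ Lemma 4.1** (computed in Strassen 1991, §6): `ζ^θ` of a matrix multiplication tensor is the
`θ`-weighted geometric mean of its three flattening dimensions — printed, for CLLZ's
`⟨a,b,c⟩ = Σ x_{ij} y_{jk} z_{ki}` (formats `ab, bc, ca`), as `ζ^θ(⟨a,b,c⟩) = a^{θ₁+θ₃} b^{θ₁+θ₂} c^{θ₂+θ₃}`;
for the tree's `matMulTensor K a b c` (formats `a·c, a·b, b·c` in the order of its three index types,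
weights `θ 0, θ 1, θ 2`) this reads `ζ^θ(⟨a,b,c⟩) = a^{θ 0+θ 1} b^{θ 1+θ 2} c^{θ 0+θ 2}` (`a, b, c ≥ 1`).
Named fact (statement only). [cite: ChristandlLeGallLysikovZuiddam2025, Lemma 4.1] -/
def CLLZ2025_lem41 : Prop :=
  ∀ (K : Type) [Field K] (θ : Fin 3 → ℝ), θ ∈ stdSimplex ℝ (Fin 3) → ∀ a b c : ℕ,
    1 ≤ a → 1 ≤ b → 1 ≤ c →
      Literature.Computability.AlgebraicComplexity.upperSupportFunctional θ (Literature.Computability.AlgebraicComplexity.matMulTensor K a b c) =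
        (a : ℝ) ^ (θ 0 + θ 1) * (b : ℝ) ^ (θ 1 + θ 2) * (c : ℝ) ^ (θ 0 + θ 2)

/-- **CLLZ Lemma 4.2, item (v)** (the only part of the adequacy of `ζ^θ` not covered by the tree's
`Strassen1991_upperSupportFunctional` and Lemma 4.1): `ζ^θ(t) ≤ R̃(t)` for every 3-tensor `t` over a
field and `θ ∈ P([3])` ("every upper support functional is at most the maximum of the flattening ranks
[Str91, p. 135], and the flattening ranks lower bound the asymptotic rank"). Named fact (statement
only). [cite: ChristandlLeGallLysikovZuiddam2025, Lemma 4.2] -/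
def CLLZ2025_lem42_v : Prop :=
  ∀ (K : Type) [Field K] (θ : Fin 3 → ℝ), θ ∈ stdSimplex ℝ (Fin 3) →
    ∀ {ι κ μ : Type} [Fintype ι] [Fintype κ] [Fintype μ] [DecidableEq ι] [DecidableEq κ]
      [DecidableEq μ] (t : ι → κ → μ → K), Literature.Computability.AlgebraicComplexity.upperSupportFunctional θ t ≤ Literature.Computability.AlgebraicComplexity.asymptoticRank t

/-- **CLLZ Lemma 4.2: the upper support functionals `ζ^θ` are adequate — PROVED** from Strassen's
theorem as vendored in the tree (`Strassen1991_upperSupportFunctional`: normalisation `ζ^θ(⟨r⟩) = r`,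
`⊕`-additivity, `⊗`-submultiplicativity, restriction-monotonicity, nonnegativity — CLLZ: "(i), (ii), (iv)
are in [Str91, Thm. 2.8]"), Lemma 4.1 ("(iii) follows from Lemma 4.1") and item (v). Self-`⊕`-additivity
`ζ^θ(⟨s⟩ ⊗ t) = s ζ^θ(t)`: `≤` by submultiplicativity and normalisation, `≥` by additivity along
`⟨s+1⟩ ⊗ t ≥ (⟨s⟩ ⊗ t) ⊕ t`. [cite: ChristandlLeGallLysikovZuiddam2025, Lemma 4.2] -/
theorem CLLZ2025_lem42 (hS : Literature.Computability.AlgebraicComplexity.Strassen1991_upperSupportFunctional.{0}) (h41 : CLLZ2025_lem41)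
    (h5 : CLLZ2025_lem42_v) (K : Type) [Field K] {θ : Fin 3 → ℝ} (hθ : θ ∈ stdSimplex ℝ (Fin 3)) :
    IsAdequate K (upperSupportPoint K θ) := by
  obtain ⟨hunit, hadd, hsub, hmono, hbounds⟩ := hS K θ hθ
  have hθ0 := hθ.1
  refine ⟨?_, ?_, ?_, ?_, ?_, ?_⟩
  · intro ι κ μ _ _ _ t
    classical
    rw [upperSupportPoint_apply]
    exact Literature.Computability.AlgebraicComplexity.upperSupportFunctional_nonneg θ t
  · intro ι κ μ ι' κ' μ' _ _ _ _ _ _ t s hts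
    classical
    obtain ⟨A, B, C, rfl⟩ := (Literature.Computability.AlgebraicComplexity.tensorRestrictsTo_iff_exists_actTensor t s).1 hts
    rw [upperSupportPoint_apply, upperSupportPoint_apply]
    exact hmono t A B C
  · intro ι κ μ ι' κ' μ' _ _ _ _ _ _ s t
    classical
    rw [upperSupportPoint_apply, upperSupportPoint_apply, upperSupportPoint_apply]
    exact hsub s t
  · intro l₁ l₂ m₁ m₂ n₁ n₂ hl₁ hl₂ hm₁ hm₂ hn₁ hn₂
    classical
    rw [upperSupportPoint_apply, upperSupportPoint_apply, upperSupportPoint_apply,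
      h41 K θ hθ _ _ _ (Nat.one_le_iff_ne_zero.2 (Nat.mul_ne_zero (by omega) (by omega)))
        (Nat.one_le_iff_ne_zero.2 (Nat.mul_ne_zero (by omega) (by omega)))
        (Nat.one_le_iff_ne_zero.2 (Nat.mul_ne_zero (by omega) (by omega))),
      h41 K θ hθ _ _ _ hl₁ hm₁ hn₁, h41 K θ hθ _ _ _ hl₂ hm₂ hn₂]
    push_cast
    rw [Real.mul_rpow (by positivity) (by positivity), Real.mul_rpow (by positivity) (by positivity),
      Real.mul_rpow (by positivity) (by positivity)]
    ring
  · intro ι κ μ _ _ _ s _ t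
    classical
    rw [upperSupportPoint_apply, upperSupportPoint_apply]
    refine le_antisymm ?_ ?_
    · calc Literature.Computability.AlgebraicComplexity.upperSupportFunctional θ (Literature.Computability.AlgebraicComplexity.kroneckerTensor (Literature.Computability.AlgebraicComplexity.unitTensor K s) t)
          ≤ Literature.Computability.AlgebraicComplexity.upperSupportFunctional θ (Literature.Computability.AlgebraicComplexity.unitTensor K s) * Literature.Computability.AlgebraicComplexity.upperSupportFunctional θ t := hsub _ _
        _ = s * Literature.Computability.AlgebraicComplexity.upperSupportFunctional θ t := by rw [hunit s]
    · -- `≥` for every `n : ℕ`, by induction along `⟨n+1⟩ ⊗ t ≥ (⟨n⟩ ⊗ t) ⊕ t` and additivity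
      have key : ∀ n : ℕ, (n : ℝ) * Literature.Computability.AlgebraicComplexity.upperSupportFunctional θ t ≤
          Literature.Computability.AlgebraicComplexity.upperSupportFunctional θ (Literature.Computability.AlgebraicComplexity.kroneckerTensor (Literature.Computability.AlgebraicComplexity.unitTensor K n) t) := by
        intro n
        induction n with
        | zero => simpa using Literature.Computability.AlgebraicComplexity.upperSupportFunctional_nonneg θ (Literature.Computability.AlgebraicComplexity.kroneckerTensor (Literature.Computability.AlgebraicComplexity.unitTensor K 0) t)
        | succ n ih =>
          obtain ⟨A, B, C, e⟩ :=
            (Literature.Computability.AlgebraicComplexity.tensorRestrictsTo_iff_exists_actTensor _ _).1 (tensorRestrictsTo_unit_succ_kronecker t n)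
          calc ((n + 1 : ℕ) : ℝ) * Literature.Computability.AlgebraicComplexity.upperSupportFunctional θ t
              = n * Literature.Computability.AlgebraicComplexity.upperSupportFunctional θ t + Literature.Computability.AlgebraicComplexity.upperSupportFunctional θ t := by push_cast; ring
            _ ≤ Literature.Computability.AlgebraicComplexity.upperSupportFunctional θ (Literature.Computability.AlgebraicComplexity.kroneckerTensor (Literature.Computability.AlgebraicComplexity.unitTensor K n) t) +
                  Literature.Computability.AlgebraicComplexity.upperSupportFunctional θ t := by linarith
            _ = Literature.Computability.AlgebraicComplexity.upperSupportFunctional θ (Literature.Computability.AlgebraicComplexity.directSumTensor (Literature.Computability.AlgebraicComplexity.kroneckerTensor (Literature.Computability.AlgebraicComplexity.unitTensor K n) t) t) :=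
                (hadd _ _).symm
            _ ≤ Literature.Computability.AlgebraicComplexity.upperSupportFunctional θ (Literature.Computability.AlgebraicComplexity.kroneckerTensor (Literature.Computability.AlgebraicComplexity.unitTensor K (n + 1)) t) := by
                rw [e]; exact hmono _ A B C
      exact key s
  · intro ι κ μ _ _ _ t
    classical
    rw [upperSupportPoint_apply]
    exact h5 K θ hθ t

variable {ι κ μ : Type} [Fintype ι] [Fintype κ] [Fintype μ] [DecidableEq ι] [DecidableEq κ]
  [DecidableEq μ]

/-- `ζ^θ` of the three elementary matrix multiplication tensors (Lemma 4.1): `log₂ ζ^θ(⟨2,1,1⟩) = θ 0 + θ 1`,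
`log₂ ζ^θ(⟨1,2,1⟩) = θ 1 + θ 2`, `log₂ ζ^θ(⟨1,1,2⟩) = θ 0 + θ 2` (tree's index convention).
[cite: ChristandlLeGallLysikovZuiddam2025, Lemma 4.1] -/
theorem CLLZ2025_lem41.logb_elementary (h41 : CLLZ2025_lem41) (K : Type) [Field K] {θ : Fin 3 → ℝ}
    (hθ : θ ∈ stdSimplex ℝ (Fin 3)) :
    Real.logb 2 (Literature.Computability.AlgebraicComplexity.upperSupportFunctional θ (Literature.Computability.AlgebraicComplexity.matMulTensor K 2 1 1)) = θ 0 + θ 1 ∧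
      Real.logb 2 (Literature.Computability.AlgebraicComplexity.upperSupportFunctional θ (Literature.Computability.AlgebraicComplexity.matMulTensor K 1 2 1)) = θ 1 + θ 2 ∧
        Real.logb 2 (Literature.Computability.AlgebraicComplexity.upperSupportFunctional θ (Literature.Computability.AlgebraicComplexity.matMulTensor K 1 1 2)) = θ 0 + θ 2 := by
  have h2 : (1 : ℝ) < 2 := one_lt_two
  refine ⟨?_, ?_, ?_⟩
  · rw [h41 K θ hθ 2 1 1 (by norm_num) le_rfl le_rfl]
    push_cast
    simp [Real.logb_rpow two_pos h2.ne']
  · rw [h41 K θ hθ 1 2 1 le_rfl (by norm_num) le_rfl]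
    push_cast
    simp [Real.logb_rpow two_pos h2.ne']
  · rw [h41 K θ hθ 1 1 2 le_rfl le_rfl (by norm_num)]
    push_cast
    simp [Real.logb_rpow two_pos h2.ne']

/-- **CLLZ eq. (5), proved from Lemma 4.2 (adequacy) and Lemma 4.1:** for every field `K` (index types in
`Type`), `θ ∈ P([3])`, tensor `T` with `ζ^θ(T) > 1` and every `T`-method bound `ω̂` on `ω(p)`:
`ω̂ ≥ ((1 + θ 1) + p (1 − θ 1)) · log R̃(T) / log ζ^θ(T)` (printed: `(2θ₁ + θ₂ + θ₃ + p(θ₂ + θ₃)) /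
log ζ^θ(T) · log R̃(T)` in CLLZ's labelling of the three factors). [cite: ChristandlLeGallLysikovZuiddam2025, §4.1 (eq. (5))] -/
theorem IsAdequate.barrier_upperSupport (h41 : CLLZ2025_lem41) {K : Type} [Field K] {θ : Fin 3 → ℝ}
    (hθ : θ ∈ stdSimplex ℝ (Fin 3)) (hA : IsAdequate K (upperSupportPoint K θ)) {T : ι → κ → μ → K}
    (hT : 1 < Literature.Computability.AlgebraicComplexity.upperSupportFunctional θ T) {p ω : ℝ} (h : IsTMethodBound K T p ω) :
    Real.log (Literature.Computability.AlgebraicComplexity.asymptoticRank T) / Real.log (Literature.Computability.AlgebraicComplexity.upperSupportFunctional θ T) *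
        ((1 + θ 1) + p * (1 - θ 1)) ≤ ω := by
  have hsum : θ 0 + θ 1 + θ 2 = 1 := by simpa [Fin.sum_univ_three] using hθ.2
  have hT' : 1 < upperSupportPoint K θ T := by rwa [upperSupportPoint_apply]
  have hB := hA.barrier hT' h
  obtain ⟨e1, e2, e3⟩ := h41.logb_elementary K hθ
  rw [upperSupportPoint_apply, upperSupportPoint_apply, upperSupportPoint_apply,
    upperSupportPoint_apply, e1, e2, e3] at hB
  have he : θ 0 + θ 1 + (θ 1 + θ 2) + p * (θ 0 + θ 2) = (1 + θ 1) + p * (1 - θ 1) := by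
    linear_combination (1 + p) * hsum
  rwa [he] at hB

/-- **CLLZ Thm. 3.22 with Lemma 4.1 (§4.3), proved:** every `T`-method lower bound `p` on `α` satisfies
`p ≤ (2 log ζ^θ(T) / log R̃(T) − (1 + θ 1)) / (1 − θ 1)` (`θ ∈ P([3])`, `θ 1 < 1`, `ζ^θ(T) > 1`; printed
for `CW_q` as `p ≤ min_θ 2 log₂ ζ^θ(CW_q)/(log₂ R̃(CW_q) (θ₂+θ₃)) − (1 + θ₁)/(θ₂ + θ₃)`).
[cite: ChristandlLeGallLysikovZuiddam2025, §4.3] -/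
theorem IsAdequate.alpha_barrier_upperSupport (h41 : CLLZ2025_lem41) {K : Type} [Field K]
    {θ : Fin 3 → ℝ} (hθ : θ ∈ stdSimplex ℝ (Fin 3)) (hθ1 : θ 1 < 1)
    (hA : IsAdequate K (upperSupportPoint K θ)) {T : ι → κ → μ → K}
    (hT : 1 < Literature.Computability.AlgebraicComplexity.upperSupportFunctional θ T) {p : ℝ} (h : IsTMethodAlphaBound K T p) :
    p ≤ (2 * Real.log (Literature.Computability.AlgebraicComplexity.upperSupportFunctional θ T) / Real.log (Literature.Computability.AlgebraicComplexity.asymptoticRank T) - (1 + θ 1)) /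
      (1 - θ 1) := by
  have hθ0 := hθ.1
  have hsum : θ 0 + θ 1 + θ 2 = 1 := by simpa [Fin.sum_univ_three] using hθ.2
  have hB := hA.barrier_upperSupport h41 hθ hT h
  have hT' : 1 < upperSupportPoint K θ T := by rwa [upperSupportPoint_apply]
  have hf0 : 0 < Real.log (Literature.Computability.AlgebraicComplexity.upperSupportFunctional θ T) := Real.log_pos hT
  have hRT : upperSupportPoint K θ T ≤ Literature.Computability.AlgebraicComplexity.asymptoticRank T := hA.le_asymptoticRank T
  rw [upperSupportPoint_apply] at hRT
  have hR0 : 0 < Real.log (Literature.Computability.AlgebraicComplexity.asymptoticRank T) := hf0.trans_le (Real.log_le_log (by linarith) hRT)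
  have he₃ : 0 < 1 - θ 1 := by linarith
  rw [le_div_iff₀ he₃, le_sub_iff_add_le, le_div_iff₀ hR0]
  rw [div_mul_eq_mul_div, div_le_iff₀ hf0] at hB
  nlinarith

end Support

/-! ## Footnote 3: universal spectral points are adequate -/

section Footnote3

variable {K : Type u} [Field K]

/-- `⟨l₁,m₁,n₁⟩ ⊗ ⟨l₂,m₂,n₂⟩ ≥ ⟨l₁l₂, m₁m₂, n₁n₂⟩` (block matrices; in fact an isomorphism).
[folklore] -/
theorem tensorRestrictsTo_kronecker_matMul_matMul (l₁ l₂ m₁ m₂ n₁ n₂ : ℕ) :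
    Literature.Computability.AlgebraicComplexity.TensorRestrictsTo (Literature.Computability.AlgebraicComplexity.kroneckerTensor (Literature.Computability.AlgebraicComplexity.matMulTensor K l₁ m₁ n₁) (Literature.Computability.AlgebraicComplexity.matMulTensor K l₂ m₂ n₂))
      (Literature.Computability.AlgebraicComplexity.matMulTensor K (l₁ * l₂) (m₁ * m₂) (n₁ * n₂)) := by
  have h : Literature.Computability.AlgebraicComplexity.matMulTensor K (l₁ * l₂) (m₁ * m₂) (n₁ * n₂) = fun A B C =>
      Literature.Computability.AlgebraicComplexity.kroneckerTensor (Literature.Computability.AlgebraicComplexity.matMulTensor K l₁ m₁ n₁) (Literature.Computability.AlgebraicComplexity.matMulTensor K l₂ m₂ n₂)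
        (((finProdFinEquiv.symm A.1).1, (finProdFinEquiv.symm A.2).1),
          ((finProdFinEquiv.symm A.1).2, (finProdFinEquiv.symm A.2).2))
        (((finProdFinEquiv.symm B.1).1, (finProdFinEquiv.symm B.2).1),
          ((finProdFinEquiv.symm B.1).2, (finProdFinEquiv.symm B.2).2))
        (((finProdFinEquiv.symm C.1).1, (finProdFinEquiv.symm C.2).1),
          ((finProdFinEquiv.symm C.1).2, (finProdFinEquiv.symm C.2).2)) := by
    funext A B C
    obtain ⟨I, L⟩ := A
    obtain ⟨I', J⟩ := B
    obtain ⟨J', L'⟩ := C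
    simp only [Literature.Computability.AlgebraicComplexity.matMulTensor, Literature.Computability.AlgebraicComplexity.kroneckerTensor_apply, ite_zero_mul_ite_zero, one_mul]
    congr 1
    simp only [eq_iff_iff]
    constructor
    · rintro ⟨rfl, rfl, rfl⟩
      exact ⟨⟨rfl, rfl, rfl⟩, rfl, rfl, rfl⟩
    · rintro ⟨⟨h₁, h₂, h₃⟩, h₄, h₅, h₆⟩
      refine ⟨finProdFinEquiv.symm.injective (Prod.ext h₁ h₄),
        finProdFinEquiv.symm.injective (Prod.ext h₂ h₅), finProdFinEquiv.symm.injective (Prod.ext h₃ h₆)⟩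
  rw [h]
  exact Literature.Computability.AlgebraicComplexity.TensorRestrictsTo.comap _ _ _ _

/-- `⟨l₁l₂, m₁m₂, n₁n₂⟩ ≥ ⟨l₁,m₁,n₁⟩ ⊗ ⟨l₂,m₂,n₂⟩` (the inverse reindexing). [folklore] -/
theorem tensorRestrictsTo_matMul_kronecker_matMul (l₁ l₂ m₁ m₂ n₁ n₂ : ℕ) :
    Literature.Computability.AlgebraicComplexity.TensorRestrictsTo (Literature.Computability.AlgebraicComplexity.matMulTensor K (l₁ * l₂) (m₁ * m₂) (n₁ * n₂))
      (Literature.Computability.AlgebraicComplexity.kroneckerTensor (Literature.Computability.AlgebraicComplexity.matMulTensor K l₁ m₁ n₁) (Literature.Computability.AlgebraicComplexity.matMulTensor K l₂ m₂ n₂)) := by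
  have h : Literature.Computability.AlgebraicComplexity.kroneckerTensor (Literature.Computability.AlgebraicComplexity.matMulTensor K l₁ m₁ n₁) (Literature.Computability.AlgebraicComplexity.matMulTensor K l₂ m₂ n₂) = fun a b c =>
      Literature.Computability.AlgebraicComplexity.matMulTensor K (l₁ * l₂) (m₁ * m₂) (n₁ * n₂)
        (finProdFinEquiv (a.1.1, a.2.1), finProdFinEquiv (a.1.2, a.2.2))
        (finProdFinEquiv (b.1.1, b.2.1), finProdFinEquiv (b.1.2, b.2.2))
        (finProdFinEquiv (c.1.1, c.2.1), finProdFinEquiv (c.1.2, c.2.2)) := by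
    funext a b c
    obtain ⟨⟨i₁, k₁⟩, ⟨i₂, k₂⟩⟩ := a
    obtain ⟨⟨i₁', j₁⟩, ⟨i₂', j₂⟩⟩ := b
    obtain ⟨⟨j₁', k₁'⟩, ⟨j₂', k₂'⟩⟩ := c
    simp only [Literature.Computability.AlgebraicComplexity.matMulTensor, Literature.Computability.AlgebraicComplexity.kroneckerTensor_apply, ite_zero_mul_ite_zero, one_mul,
      EmbeddingLike.apply_eq_iff_eq, Prod.mk.injEq]
    congr 1
    simp only [eq_iff_iff]
    tauto
  rw [h]
  exact Literature.Computability.AlgebraicComplexity.TensorRestrictsTo.comap _ _ _ _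

/-- `⟨s+1⟩ ≥ ⟨s⟩ ⊕ ⟨1⟩`. [folklore] -/
theorem tensorRestrictsTo_unit_succ_directSum (s : ℕ) :
    Literature.Computability.AlgebraicComplexity.TensorRestrictsTo (Literature.Computability.AlgebraicComplexity.unitTensor K (s + 1)) (Literature.Computability.AlgebraicComplexity.directSumTensor (Literature.Computability.AlgebraicComplexity.unitTensor K s) (Literature.Computability.AlgebraicComplexity.unitTensor K 1)) := by
  have h : Literature.Computability.AlgebraicComplexity.directSumTensor (Literature.Computability.AlgebraicComplexity.unitTensor K s) (Literature.Computability.AlgebraicComplexity.unitTensor K 1) = fun a b c =>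
      Literature.Computability.AlgebraicComplexity.unitTensor K (s + 1) (Sum.elim Fin.castSucc (fun _ => Fin.last s) a)
        (Sum.elim Fin.castSucc (fun _ => Fin.last s) b) (Sum.elim Fin.castSucc (fun _ => Fin.last s) c) := by
    funext a b c
    rcases a with i | i <;> rcases b with j | j <;> rcases c with l | l <;>
      simp [Literature.Computability.AlgebraicComplexity.directSumTensor, Literature.Computability.AlgebraicComplexity.unitTensor, Fin.castSucc_ne_last, (Fin.castSucc_lt_last _).ne',
        Fin.fin_one_eq_zero]
  rw [h]
  exact Literature.Computability.AlgebraicComplexity.TensorRestrictsTo.comap _ _ _ _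

/-- `⟨s⟩ ⊕ ⟨1⟩ ≥ ⟨s+1⟩`. [folklore] -/
theorem tensorRestrictsTo_directSum_unit_succ (s : ℕ) :
    Literature.Computability.AlgebraicComplexity.TensorRestrictsTo (Literature.Computability.AlgebraicComplexity.directSumTensor (Literature.Computability.AlgebraicComplexity.unitTensor K s) (Literature.Computability.AlgebraicComplexity.unitTensor K 1)) (Literature.Computability.AlgebraicComplexity.unitTensor K (s + 1)) := by
  have h : Literature.Computability.AlgebraicComplexity.unitTensor K (s + 1) = fun a b c =>
      Literature.Computability.AlgebraicComplexity.directSumTensor (Literature.Computability.AlgebraicComplexity.unitTensor K s) (Literature.Computability.AlgebraicComplexity.unitTensor K 1) (finSumFinEquiv.symm a) (finSumFinEquiv.symm b)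
        (finSumFinEquiv.symm c) := by
    funext a b c
    obtain ⟨x, rfl⟩ := finSumFinEquiv.surjective a
    obtain ⟨y, rfl⟩ := finSumFinEquiv.surjective b
    obtain ⟨z, rfl⟩ := finSumFinEquiv.surjective c
    simp only [Equiv.symm_apply_apply, Literature.Computability.AlgebraicComplexity.unitTensor_apply, EmbeddingLike.apply_eq_iff_eq]
    rcases x with i | i <;> rcases y with j | j <;> rcases z with l | l <;>
      simp [Literature.Computability.AlgebraicComplexity.directSumTensor, Literature.Computability.AlgebraicComplexity.unitTensor, Fin.fin_one_eq_zero]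
  rw [h]
  exact Literature.Computability.AlgebraicComplexity.TensorRestrictsTo.comap _ _ _ _

/-- A universal spectral point takes the value `r` at `⟨r⟩` (normalisation and additivity).
[cite: ChristandlVranaZuiddam2023, §1.2] -/
theorem _root_.Literature.Computability.AlgebraicComplexity.IsUniversalSpectralPoint.map_unitTensor {F : Literature.Computability.AlgebraicComplexity.SpectralMap K} (hF : Literature.Computability.AlgebraicComplexity.IsUniversalSpectralPoint K F)
    (r : ℕ) : F (Literature.Computability.AlgebraicComplexity.unitTensor K r) = r := by
  induction r with
  | zero =>
    have h0 : Literature.Computability.AlgebraicComplexity.unitTensor K 0 = (0 : Fin 0 → Fin 0 → Fin 0 → K) := funext fun a => Fin.elim0 a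
    rw [h0, hF.map_zero]
    simp
  | succ r ih =>
    rw [← hF.eq_of_restrictsTo (tensorRestrictsTo_unit_succ_directSum r)
      (tensorRestrictsTo_directSum_unit_succ r), hF.map_directSum, ih, hF.map_unitTensor_one]
    push_cast
    ring

/-- **CLLZ footnote 3** ("Generally, all elements in the asymptotic spectrum of tensors [Str88] are
adequate maps"), PROVED for the tree's `IsUniversalSpectralPoint`, given Strassen's duality
`ξ(t) ≤ R̃(t)` for (v) (named fact `strassen_duality_asymptoticRank` of `AsymptoticSpectrum.lean`).
In particular the quantum functionals over `ℂ` are adequate. [cite: ChristandlLeGallLysikovZuiddam2025, §1.3.1 (footnote 3)] -/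
theorem _root_.Literature.Computability.AlgebraicComplexity.IsUniversalSpectralPoint.isAdequate {F : Literature.Computability.AlgebraicComplexity.SpectralMap K} (hF : Literature.Computability.AlgebraicComplexity.IsUniversalSpectralPoint K F)
    (hd : Literature.Computability.AlgebraicComplexity.strassen_duality_asymptoticRank K) : IsAdequate K F where
  nonneg t := hF.nonneg t
  mono t s h := hF.mono t s h
  submultiplicative s t := (hF.map_kronecker s t).le
  mamu l₁ l₂ m₁ m₂ n₁ n₂ _ _ _ _ _ _ := by
    rw [hF.eq_of_restrictsTo (tensorRestrictsTo_kronecker_matMul_matMul l₁ l₂ m₁ m₂ n₁ n₂)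
      (tensorRestrictsTo_matMul_kronecker_matMul l₁ l₂ m₁ m₂ n₁ n₂), hF.map_kronecker]
  selfAdditive s _ t := by rw [hF.map_kronecker, hF.map_unitTensor]
  le_asymptoticRank t := (hd t).1 F hF

end Footnote3

/-! ## Soundness of the class and the numerical barriers for `CW_q` (CLLZ §2, §1.3.1, §4.4) -/

section Numerics

/-- **`T`-methods give true upper bounds on `ω(p)`** (CLLZ Thm. 2.1: `m ≥ n^p`, `R̃(⟨n,n,m⟩^{⊕s}) ≤ r ⟹
s n^{ω(p)} ≤ r`, by the asymptotic sum inequality for rectangular matrix multiplication [LR83] and the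
monotonicity of `ω(p)`; Def. 3.9 "Then Thm. 2.1 gives the upper bound `ω(p) ≤ ω̂(p)`"; Def. 3.12 and
Rem. 3.13 for asymptotic methods, by continuity of `p ↦ ω(p)` [LR83]). CLLZ's `ω(p)` is the exponent
of `n × ⌈n^p⌉` times `⌈n^p⌉ × n` (footnote 1; the tree's `omegaRect K 1 p 1`, middle placement, in
which `dualExponentAlpha` is defined) and is used for `⟨n,n,m⟩`, `m ≥ n^p` (Thm. 2.1; last placement,
`omegaRect K 1 1 p`); both conclusions are recorded. `p ≥ 0`. Named fact (statement only).
[cite: ChristandlLeGallLysikovZuiddam2025, Thm. 2.1 and Rem. 3.13] -/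
def CLLZ2025_tMethodBound_sound : Prop :=
  ∀ (K : Type) [Field K] {ι κ μ : Type} [Fintype ι] [Fintype κ] [Fintype μ] (T : ι → κ → μ → K)
    (p ω : ℝ), 0 ≤ p → IsTMethodBound K T p ω → Literature.Computability.AlgebraicComplexity.omegaRect K 1 1 p ≤ ω ∧ Literature.Computability.AlgebraicComplexity.omegaRect K 1 p 1 ≤ ω

/-- With soundness: a `T`-method lower bound `p ≥ 0` on `α` certifies `ω(1,p,1) ≤ 2` (the quantity
whose level set `{a ∈ [0,1] | ω(1,a,1) = 2}` defines `dualExponentAlpha`).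
[cite: ChristandlLeGallLysikovZuiddam2025, Thm. 3.22 (proof)] -/
theorem CLLZ2025_tMethodBound_sound.omegaRect_le_two (hs : CLLZ2025_tMethodBound_sound) (K : Type)
    [Field K] {ι κ μ : Type} [Fintype ι] [Fintype κ] [Fintype μ] {T : ι → κ → μ → K} {p : ℝ}
    (hp : 0 ≤ p) (h : IsTMethodAlphaBound K T p) : Literature.Computability.AlgebraicComplexity.omegaRect K 1 p 1 ≤ 2 :=
  (hs K T p 2 hp h).2

/-- **CLLZ, barrier on `α` for the big Coppersmith–Winograd tensors**, with the constant of the 2020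
version (arXiv v1, abstract: "any lower bound on the dual exponent of matrix multiplication `α` via the
big Coppersmith–Winograd tensors cannot exceed `0.625`"; §1.3.1: "the best lower bound on `α` obtainable
with degenerations via `CW_q` for any `q`, cannot exceed `0.625`", the highest point of Fig. 2,
`q ∈ {2,…,8}`): for every field, every `q ≥ 2` and every `T`-method lower bound `p` on `α` with
`T = CW_q` (restriction reductions, a subclass of the printed degeneration methods), `p ≤ 0.625`. The
journal/v2 version prints `0.6218` (abstract, §1.3.1, Table 3 at `q = 2`), a solver output (App. A,
`θ₁ = 0.999999`) which lies BELOW the exact value `3 − (3/2) log₂ 3 = 0.62256` of the printed §4.3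
expression for `CW_2` (the best bound Thm. 3.22 with Lemma 4.1/4.2 gives there), so `0.6218` is not
established by the printed proof and is not vendored; `0.625 ≥ 0.62256` is (reviews of p6966/p7537 and
`scope_caveats` (e)). `CW_q = x₀y₀z_{q+1} + x₀y_{q+1}z₀ + x_{q+1}y₀z₀ + Σ_{i=1}^q (x₀yᵢzᵢ + xᵢy₀zᵢ + xᵢyᵢz₀)`
(CLLZ §2, support as in §4.2) is written inline on `Fin (q+2)`, `q+1 = Fin.last (q+1)`
(`= bigCwTensor K q` of `IrreversibilityBarrier.lean`). Named fact (numerical, statement only).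
[cite: ChristandlLeGallLysikovZuiddam2020, abstract and §1.3.1 (Fig. 2)] -/
def CLLZ2025_alpha_barrier_CW : Prop :=
  ∀ (K : Type) [Field K] (q : ℕ), 2 ≤ q → ∀ p : ℝ,
    IsTMethodAlphaBound K
      (fun a b c : Fin (q + 2) =>
      if (a = 0 ∧ b = c ∧ b ≠ 0 ∧ b ≠ Fin.last (q + 1)) ∨
          (b = 0 ∧ a = c ∧ a ≠ 0 ∧ a ≠ Fin.last (q + 1)) ∨
          (c = 0 ∧ a = b ∧ a ≠ 0 ∧ a ≠ Fin.last (q + 1)) ∨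
          (a = 0 ∧ b = 0 ∧ c = Fin.last (q + 1)) ∨
          (a = 0 ∧ b = Fin.last (q + 1) ∧ c = 0) ∨
          (a = Fin.last (q + 1) ∧ b = 0 ∧ c = 0) then (1 : K) else 0) p → p ≤ 0.625

/-- **CLLZ Table 1** (§4.4): "Barriers for upper bounds on `ω(2)` via asymptotic `CW_q`-methods for small
`q`" (numerical optimisation of eq. (5) over `θ₁ ∈ {0.001, …, 0.2}`, `θ₂ = θ₃`, truncated to four
decimals, App. A; every row is reproduced by exact evaluation, reviews of p7537): pairs `(q, b_q)`,
`q = 2, …, 14`, as printed. [cite: ChristandlLeGallLysikovZuiddam2025, §4.4 (Table 1)] -/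
def cllz2025OmegaTwoTable : List (ℕ × ℝ) :=
  [(2, 3.0626), (3, 3.0726), (4, 3.0831), (5, 3.0936), (6, 3.1039), (7, 3.1138), (8, 3.1232),
    (9, 3.1323), (10, 3.1409), (11, 3.1491), (12, 3.1569), (13, 3.1643), (14, 3.1714)]

/-- **CLLZ Table 1 as a statement** (§4.4): for every row `(q, b_q)` and every field, every `CW_q`-method
upper bound `ω̂` on `ω(2)` satisfies `ω̂ ≥ b_q` (numerical values as printed; `CW_q` inline as in
`CLLZ2025_alpha_barrier_CW`). Named fact (statement only). [cite: ChristandlLeGallLysikovZuiddam2025, §4.4 (Table 1)] -/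
def CLLZ2025_omegaTwo_barrier_CW : Prop :=
  ∀ (K : Type) [Field K] (q : ℕ) (b : ℝ), (q, b) ∈ cllz2025OmegaTwoTable →
    ∀ ω : ℝ, IsTMethodBound K
      (fun a b c : Fin (q + 2) =>
      if (a = 0 ∧ b = c ∧ b ≠ 0 ∧ b ≠ Fin.last (q + 1)) ∨
          (b = 0 ∧ a = c ∧ a ≠ 0 ∧ a ≠ Fin.last (q + 1)) ∨
          (c = 0 ∧ a = b ∧ a ≠ 0 ∧ a ≠ Fin.last (q + 1)) ∨
          (a = 0 ∧ b = 0 ∧ c = Fin.last (q + 1)) ∨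
          (a = 0 ∧ b = Fin.last (q + 1) ∧ c = 0) ∨
          (a = Fin.last (q + 1) ∧ b = 0 ∧ c = 0) then (1 : K) else 0) 2 ω → b ≤ ω

/-- Headline consequence: a `CW_q`-method (`q ≥ 2`) can certify `p ≤ α` only for `p ≤ 0.625 < 1`; in
particular it cannot certify the strengthening `α = 1` of `ω = 2`.
[cite: ChristandlLeGallLysikovZuiddam2020, §1.3.1] -/
theorem CLLZ2025_alpha_barrier_CW.lt_one (h : CLLZ2025_alpha_barrier_CW) (K : Type) [Field K]
    {q : ℕ} (hq : 2 ≤ q) {p : ℝ}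
    (hp : IsTMethodAlphaBound K
      (fun a b c : Fin (q + 2) =>
      if (a = 0 ∧ b = c ∧ b ≠ 0 ∧ b ≠ Fin.last (q + 1)) ∨
          (b = 0 ∧ a = c ∧ a ≠ 0 ∧ a ≠ Fin.last (q + 1)) ∨
          (c = 0 ∧ a = b ∧ a ≠ 0 ∧ a ≠ Fin.last (q + 1)) ∨
          (a = 0 ∧ b = 0 ∧ c = Fin.last (q + 1)) ∨
          (a = 0 ∧ b = Fin.last (q + 1) ∧ c = 0) ∨
          (a = Fin.last (q + 1) ∧ b = 0 ∧ c = 0) then (1 : K) else 0) p) :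
    p < 1 :=
  (h K q hq p hp).trans_lt (by norm_num)

/-- **CLLZ Remark 3.23**: the exponent and the dual exponent satisfy `ω + ωα/2 ≤ 3` (from
`⟨n^{2+α}, n^{2+α}, n^{2+α}⟩ ≤ ⟨n^{6+o(1)}⟩`, i.e. `ω ≤ 6/(2+α)`). With the tree's `omega K` and
`dualExponentAlpha K` (`RectangularExponent.lean`). Named fact (statement only).
[cite: ChristandlLeGallLysikovZuiddam2025, Rem. 3.23] -/
def CLLZ2025_rem323 : Prop :=
  ∀ (K : Type) [Field K], Literature.Computability.AlgebraicComplexity.omega K + Literature.Computability.AlgebraicComplexity.omega K * Literature.Computability.AlgebraicComplexity.dualExponentAlpha K / 2 ≤ 3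

/-- `α = 1 ⟹ ω ≤ 2` ("If `α = 1`, then of course `ω = 2`", §1), from Rem. 3.23.
[cite: ChristandlLeGallLysikovZuiddam2025, Rem. 3.23] -/
theorem CLLZ2025_rem323.omega_le_two (h : CLLZ2025_rem323) (K : Type) [Field K]
    (hα : Literature.Computability.AlgebraicComplexity.dualExponentAlpha K = 1) : Literature.Computability.AlgebraicComplexity.omega K ≤ 2 := by
  have := h K
  rw [hα] at this
  linarith

end Numerics

/-! ## Catalogue entry (D-0021) -/

section Catalogue

/-- **Barrier for (rectangular) matrix multiplication via a fixed intermediate tensor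
(Christandl–Le Gall–Lysikov–Zuiddam 2025).** The catalogue entry bundles the two Strassen facts that,
with the tree's `Strassen1991_upperSupportFunctional`, make the upper support functionals adequate
(Lemma 4.1, Lemma 4.2(v)), the soundness of the technique class (Thm. 2.1/Rem. 3.13), Rem. 3.23, and the
numerics for `CW_q` (v1 abstract/§1.3.1 constant `0.625`, Table 1); the structural barrier itself (Thm. 1.1 =
Thm. 3.15 with Lemma 3.7, Thm. 3.10, Thm. 1.2 = Thm. 3.22, Lemma 4.2, eq. (5)) is PROVED above for the
Lean technique class `IsTMethodBound`/`IsTMethodAlphaBound` and every `IsAdequate` parameter.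

BARRIER
technique_class: T-method, asymptotic-T-method, fixed-intermediate-tensor, coppersmith-winograd, CW-tensor, laser-method, restriction, degeneration, rectangular-matrix-multiplication, dual-exponent, asymptotic-rank-of-fixed-tensor, catalytic-method, adequate-tensor-parameter
blocks: certifying the strengthening `α = 1` of `MatrixMultiplication` (`α` the dual exponent, `ω(α) = 2`; `α = 1 ⟹ ω = 2`, and `ω + ωα/2 ≤ 3`, Rem. 3.23) — indeed any lower bound `α ≥ p` with `p > 0.625` [cite: ChristandlLeGallLysikovZuiddam2020, §1.3.1] (exactly: `p > 3 − (3/2)log₂ 3 = 0.62256`, the value of the printed §4.3 expression at `q = 2`) — by an asymptotic `T`-method with `T` a big Coppersmith–Winograd tensor `CW_q`, `q ≥ 2`: reductions `T^{⊗k} ≥ ⟨n,n,m⟩^{⊕s}` with `m ≥ n^{p+o(1)}` composed with `R̃(T) ≤ r`, the scheme of the rectangular algorithms of [CW90, LG12, LU18] [cite: ChristandlLeGallLysikovZuiddam2025, §1.3.1 and Thm. 3.22]; more generally every upper bound `ω̂(p)` on a rectangular exponent `ω(p)` so obtained from any fixed `T` satisfies `ω̂(p) ≥ log₂(F(⟨2,1,1⟩)F(⟨1,2,1⟩)F(⟨1,1,2⟩)^p)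 · log R̃(T)/log F(T)` for every adequate `F` — support functionals over any field, quantum functionals over `ℂ` — plus a catalyticity term [cite: ChristandlLeGallLysikovZuiddam2025, Thm. 1.1 and Thm. 3.15], also for mixed families `CW_{q₁}^{⊗a n} ⊗ CW_{q₂}^{⊗b n}` (Coppersmith 1997) [cite: ChristandlLeGallLysikovZuiddam2025, Thm. 3.21]; numerically `ω̂(2) ≥ 3.0626 … 3.1714` via `CW_2 … CW_{14}` (Table 1) against the lower bound `ω(2) ≥ 3` [cite: ChristandlLeGallLysikovZuiddam2025, §4.4].
because: an adequate `F` (Def. 3.1: `≤`-monotone, `⊗`-submultiplicative, multiplicative on matrix multiplication tensors, self-`⊕`-additive, `F ≤ R̃`) turns `T^{⊗k} ≥ ⟨n,n,m⟩^{⊕s}` into `s · F(⟨n,n,m⟩) ≤ F(T)^k`, while the method certifies only `k log_n r − log_n s` with `r ≥ R̃(T) ≥ F(T)`; eliminating `k` gives `ω̂ ≥ (log r/log F(T)) · log_n F(⟨n,n,m⟩) + (log r/log F(T) − 1) · log_n s` (`IsAdequate.le_tMethodBound`) [cite: ChristandlLeGallLysikovZuiddam2025, Thm. 3.10], and `log_n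 F(⟨n,n,m⟩) ≥ log₂ F(⟨2,2,2^p⟩) = log₂ F(⟨2,1,1⟩) + log₂ F(⟨1,2,1⟩) + p log₂ F(⟨1,1,2⟩)` for `m ≥ n^p`, multiplicativity on matrix multiplication tensors making `a ↦ F(⟨a,1,1⟩)` a monotone multiplicative function, hence `≥ F(⟨2,1,1⟩)^{log₂ a}` (`IsAdequate.log_map_matMul_ge`, `.barrier`, `.alpha_barrier`) [cite: ChristandlLeGallLysikovZuiddam2025, Lemma 3.4 and Lemma 3.7]; the numbers come from Strassen's upper support functionals, `log₂ ζ^θ(CW_q) ≤ max_P Σ θᵢ H(Pᵢ)` over the `S_q`-symmetrised distributions on `supp(CW_q)`, `ζ^θ(⟨a,b,c⟩) = a^{θ₁+θ₃}b^{θ₁+θ₂}c^{θ₂+θ₃}` and `R̃(CW_q) = q + 2` [cite: ChristandlLeGallLysikovZuiddam2025, §4.2 and §4.3].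
evasions_known: none published for `CW_q`; the bound is a property of the intermediate tensor — it is trivial whenever `max_F log₂ F(⟨2,2,2^p⟩) log R̃(T)/log F(T) ≤ max(2, 1+p)`, so other intermediate tensors are not obstructed by this entry (for the small tensor `cw_2`, if `R̃(cw_2) = 3` there is no barrier and `ω = 2` would follow, Rem. 4.4 and Table 2) [cite: ChristandlLeGallLysikovZuiddam2025, Rem. 4.4]; catalyticity (diagonal tensors returned on the left, as in the laser method) is covered and RAISES the barrier rather than evading it [cite: ChristandlLeGallLysikovZuiddam2025, §1.3.3 and Thm. 3.15]. The small-CW route is quantitatively live: `R̃(cw_q) < q + 2 − δ_q` for every `q ≥ 2` and `R̃(cw_2) < 3.931` [cite: AlmanLi2026, Thm. 1.3] ("there is no known barrier like this to using `cw_q`", ibid.); by this entry's `IsAdequate.le_tMethodBound` with the flattening functional `ζ^θ`, `θ = (1,0,0)` (and `ζ^θ(cw_q) ≤ q + 1` for every `θ`, each marginal of `supp(cw_q)` having `q + 1` symbols), a `cw_q`-reduction run with cost bound `r ≥ R̃(cw_q)` certifies only `ω̂(1) ≥ 2 log r / log (q+1)`, so `ω = 2` via a `cw_q`-method needs `r ↓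 q + 1`, i.e. `R̃(cw_q) = q + 1` — the converse of Coppersmith–Winograd's `R̃(cw_2) = 3 ⟹ ω = 2` [cite: AlmanLi2026, Thm. 1.2] — and improving on `ω ≤ 2.371339` via `cw_2` needs `r < 3^{2.371339/2} = 3.679` against the known `3.931` (barrier audit 2026-08-15).
scope_caveats: (a) reductions are formalised with restriction (`TensorRestrictsTo`) only; the paper asserts the same for degeneration / monomial degeneration / monomial restriction (§3.1 footnote 4) and the numerical facts, printed for degeneration methods, are vendored for the restriction subclass [cite: ChristandlLeGallLysikovZuiddam2025, §3.1 (footnote 4)]; (b) `IsTMethodBound` is the ε-closure of Def. 3.9/3.12 (it contains both); its soundness `ω(p) ≤ ω̂` (Thm. 2.1, Rem. 3.13) is a named fact, not proved, recorded for both placements `ω(1,1,p)` (Thm. 2.1's `⟨n,n,m⟩`) and `ω(1,p,1)` (footnote 1, the placement of the tree's `dualExponentAlpha`); the tree has no lemma `ω(1,a,1) ≥ 2`, so the chain from a `T`-method `α`-bound to `p ≤ dualExponentAlpha` is not closed here [cite: ChristandlLeGallLysikovZuiddam2025, Thm. 2.1]; (c) Def. 3.1(iii) is required for positive formats only and (iv)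 is stated for `⟨s⟩ ⊗ T ≅ T^{⊕s}`; adequacy of `ζ^θ` (Lemma 4.2) is proved modulo the tree's `Strassen1991_upperSupportFunctional` and the named facts Lemma 4.1 and `ζ^θ ≤ R̃`, adequacy of universal spectral points (footnote 3) modulo the tree's `strassen_duality_asymptoticRank` [cite: ChristandlLeGallLysikovZuiddam2025, Def. 3.1 and Lemma 4.2]; (d) the κ-catalytic refinements beyond one reduction, mixed methods (Thm. 3.21), Table 2 (`cw_q`) and Thm. 2.1 are not vendored; (e) numerics: Table 1 is vendored as printed (truncated grid maxima, all rows reproduced); the v2 headline `0.6218` and Table 3 are NOT vendored because the printed values for `q = 2, 4, 6, 11, 12, 14` lie below the exact values of the printed §4.3 expression (`θ₁ → 1` limit `g*(q)`; `q = 2`: `3 − (3/2)log₂ 3 = 0.62256 > 0.6218`), i.e. below what Thm. 3.22 with Lemma 4.1/4.2 establishes for the tight tensors `CW_q` (solver error at `θ₁ = 0.999999`, App. A), while rows `3, 5, 7–10, 13` are established; the `α`-fact therefore carries the v1 constant `0.625` (v1 abstract/§1.3.1, `≥ 0.62256`) and is stated for `q ≥ 2`, the range of Fig. 2 ("for any `q`"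 over-claims at `q = 1`: `g*(1) = 0.6407`); the exact evaluation is this entry's and the reviewers' replication, not a published source [cite: ChristandlLeGallLysikovZuiddam2025, §4.3 and App. A] [cite: ChristandlLeGallLysikovZuiddam2020, §1.3.1]; (f) at `p = 1` the entry reduces to the irreversibility / asymptotic-slice-rank barriers (`IrreversibilityBarrier.lean`, `UniversalMethodBarrier.lean`) [cite: ChristandlLeGallLysikovZuiddam2025, Rem. 1.3]. (g) certificate shape: `IsTMethodReduction` asks for a RESTRICTION from `T^{⊗k}` itself, whereas the laser-method outputs as printed since [cite: VassilevskaWilliamsXuXuZhou2024, Thm. 5.3] and as assembled in the tree (`Literature.Computability.AlgebraicComplexity.omega_le_of_forall_polyDegeneratesTo`: `⟨M⟩ ⊗ CW_q^{⊗N} ⊵ ⟨t⟩ ⊗ ⟨a,a,a⟩`, `M = 2^{o(N)}` borrowed diagonal, a degeneration over `K[λ]` of some order `h`) are not syntactically of that shape; they enter `IsTMethodBound` through the standard bridge `t ⊴_h s ⟹ t ≤ s ⊗ M_h ≤ s ⊗ ⟨(h+1)²⟩` (`Literature.Computability.AlgebraicComplexity.IsApproxRestriction.restrictsTo_kronecker_coeffTensor`)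 [cite: BurgisserClausenShokrollahi1997, (15.26)] followed by `CW_q^{⊗N'} ≥ ⟨(h+1)² M⟩` with `N' = O(log ((h+1)² M))` (`Q̃(CW_q) > 1`, e.g. by the first-power Coppersmith–Winograd restriction itself [cite: CoppersmithWinograd1990, §7]), which is `o(N)` as soon as `log M, log h = o(N)` (the regime of every `CW_q` analysis, orders adding linearly along Kronecker powers) and then moves `k log_n r − log_n s` by `o(1)`; the bridge is not formalised in this file, so the proved barrier meets such certificates — and the degeneration methods of (a) — at the level of exponents (inside the ε-closure `IsTMethodBound`), not syntactically [cite: ChristandlLeGallLysikovZuiddam2025, §3.1 (footnote 4)]; (h) `α = 1 ⟺ ω = 2` (`ω(1,a,1) ≤ ω` for `a ≤ 1`, and Rem. 3.23), so the "strengthening" `α = 1` is an equivalent form of the summit and the entry's force is the quantitative cap `p ≤ 0.625` on certifiable `α ≥ p`; the infimum over ALL `θ ∈ P([3])` (also `θ₂ ≠ θ₃`) of the §4.3 expression for `CW_2` is the symmetric `θ₁ → 1` limit `0.62256` of (e) (audit scan 2026-08-15) [cite: ChristandlLeGallLysikovZuiddam2025, Rem. 3.23].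
status: theorem (established) [cite: ChristandlLeGallLysikovZuiddam2025, Thm. 3.15 and Thm. 3.22]; structural part proved in this file; soundness, the two Strassen lemmas, Table 1 and the v1 constant `0.625` are named facts (established as stated); the v2 constant `0.6218`/Table 3 are not vendored (caveat (e)) — UPDATE (barrier audit 2026-08-15): all six named facts are meanwhile PROVED in sibling files — soundness (`RectangularBarrierSoundness.lean`), Lemma 4.1 (`RectangularBarrierLem41Proofs.lean`), `ζ^θ ≤ R̃` (`RectangularBarrierUpperSupportProofs.lean`), Rem. 3.23 (`RectangularBarrierProofs.lean`), the `0.625` constant for all `q ≥ 2` over every field (`RectangularBarrierAlphaCW.lean`, exact dual certificate) and Table 1 (`RectangularBarrierOmegaTwoCW.lean`, certified numerics) — and the conjunction is the unconditional theorem `RectangularBarrier_holds` (`RectangularBarrierHolds.lean`; axiom closure `propext`, `Classical.choice`, `Quot.sound`); the words "named fact, not proved" in (b), (c) above are historical; audit verdict CONFIRMED (technique class = Def. 3.10/3.12 incl. degeneration and borrowed-diagonal certificates at exponent level, caveat (g); scope as stated; no evading literature for `CW_q`, see `evasions_known`) -/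
def RectangularBarrier : Prop :=
  CLLZ2025_lem41 ∧ CLLZ2025_lem42_v ∧ CLLZ2025_tMethodBound_sound ∧ CLLZ2025_rem323 ∧
    CLLZ2025_alpha_barrier_CW ∧ CLLZ2025_omegaTwo_barrier_CW

/-- Projection: Lemma 4.1. [cite: ChristandlLeGallLysikovZuiddam2025, Lemma 4.1] -/
theorem RectangularBarrier.lem41 (h : RectangularBarrier) : CLLZ2025_lem41 := h.1

/-- Projection: Lemma 4.2 (v), `ζ^θ ≤ R̃`. [cite: ChristandlLeGallLysikovZuiddam2025, Lemma 4.2] -/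
theorem RectangularBarrier.lem42_v (h : RectangularBarrier) : CLLZ2025_lem42_v := h.2.1

/-- Projection: soundness of `T`-methods. [cite: ChristandlLeGallLysikovZuiddam2025, Thm. 2.1] -/
theorem RectangularBarrier.sound (h : RectangularBarrier) : CLLZ2025_tMethodBound_sound := h.2.2.1

/-- Projection: Rem. 3.23. [cite: ChristandlLeGallLysikovZuiddam2025, Rem. 3.23] -/
theorem RectangularBarrier.rem323 (h : RectangularBarrier) : CLLZ2025_rem323 := h.2.2.2.1

/-- Projection: the `0.625` barrier for `CW_q`, `q ≥ 2`. [cite: ChristandlLeGallLysikovZuiddam2020, §1.3.1] -/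
theorem RectangularBarrier.alpha_CW (h : RectangularBarrier) : CLLZ2025_alpha_barrier_CW :=
  h.2.2.2.2.1

/-- Projection: Table 1. [cite: ChristandlLeGallLysikovZuiddam2025, §4.4 (Table 1)] -/
theorem RectangularBarrier.omegaTwo_CW (h : RectangularBarrier) : CLLZ2025_omegaTwo_barrier_CW :=
  h.2.2.2.2.2

/-- Adequacy of `ζ^θ` from the entry and Strassen's theorem (Lemma 4.2).
[cite: ChristandlLeGallLysikovZuiddam2025, Lemma 4.2] -/
theorem RectangularBarrier.isAdequate_upperSupport (h : RectangularBarrier)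
    (hS : Literature.Computability.AlgebraicComplexity.Strassen1991_upperSupportFunctional.{0}) (K : Type) [Field K] {θ : Fin 3 → ℝ}
    (hθ : θ ∈ stdSimplex ℝ (Fin 3)) : IsAdequate K (upperSupportPoint K θ) :=
  CLLZ2025_lem42 hS h.lem41 h.lem42_v K hθ

/-- The entry in its general form for upper support functionals (eq. (5)), any field (in `Type`), any
intermediate tensor `T` with `ζ^θ(T) > 1`: every `T`-method bound on `ω(p)` is
`≥ ((1 + θ 1) + p (1 − θ 1)) · log R̃(T) / log ζ^θ(T)`. [cite: ChristandlLeGallLysikovZuiddam2025, §4.1 (eq. (5))] -/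
theorem RectangularBarrier.upperSupport (h : RectangularBarrier)
    (hS : Literature.Computability.AlgebraicComplexity.Strassen1991_upperSupportFunctional.{0}) {K : Type} [Field K]
    {ι κ μ : Type} [Fintype ι] [Fintype κ] [Fintype μ] [DecidableEq ι] [DecidableEq κ]
    [DecidableEq μ] {θ : Fin 3 → ℝ} (hθ : θ ∈ stdSimplex ℝ (Fin 3)) {T : ι → κ → μ → K}
    (hT : 1 < Literature.Computability.AlgebraicComplexity.upperSupportFunctional θ T) {p ω : ℝ} (hω : IsTMethodBound K T p ω) :
    Real.log (Literature.Computability.AlgebraicComplexity.asymptoticRank T) / Real.log (Literature.Computability.AlgebraicComplexity.upperSupportFunctional θ T) *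
        ((1 + θ 1) + p * (1 - θ 1)) ≤ ω :=
  (h.isAdequate_upperSupport hS K hθ).barrier_upperSupport h.lem41 hθ hT hω

/-- The entry's `α`-form for upper support functionals (§4.3), any field (in `Type`), any `T` with
`ζ^θ(T) > 1`, `θ 1 < 1`: every `T`-method lower bound `p` on `α` is
`≤ (2 log ζ^θ(T)/log R̃(T) − (1 + θ 1))/(1 − θ 1)`. [cite: ChristandlLeGallLysikovZuiddam2025, §4.3] -/
theorem RectangularBarrier.alpha_upperSupport (h : RectangularBarrier)
    (hS : Literature.Computability.AlgebraicComplexity.Strassen1991_upperSupportFunctional.{0}) {K : Type} [Field K]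
    {ι κ μ : Type} [Fintype ι] [Fintype κ] [Fintype μ] [DecidableEq ι] [DecidableEq κ]
    [DecidableEq μ] {θ : Fin 3 → ℝ} (hθ : θ ∈ stdSimplex ℝ (Fin 3)) (hθ1 : θ 1 < 1)
    {T : ι → κ → μ → K} (hT : 1 < Literature.Computability.AlgebraicComplexity.upperSupportFunctional θ T) {p : ℝ}
    (hp : IsTMethodAlphaBound K T p) :
    p ≤ (2 * Real.log (Literature.Computability.AlgebraicComplexity.upperSupportFunctional θ T) / Real.log (Literature.Computability.AlgebraicComplexity.asymptoticRank T) - (1 + θ 1)) /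
      (1 - θ 1) :=
  (h.isAdequate_upperSupport hS K hθ).alpha_barrier_upperSupport h.lem41 hθ hθ1 hT hp

/-- With the headline numerics: a `CW_q`-method (`q ≥ 2`) certifies `p ≤ α` (i.e. `ω(p) ≤ 2`) only
for `p ≤ 0.625`. [cite: ChristandlLeGallLysikovZuiddam2020, §1.3.1] -/
theorem RectangularBarrier.alpha_CW_le (h : RectangularBarrier) (K : Type) [Field K] {q : ℕ}
    (hq : 2 ≤ q) {p : ℝ}
    (hp : IsTMethodAlphaBound K
      (fun a b c : Fin (q + 2) =>
      if (a = 0 ∧ b = c ∧ b ≠ 0 ∧ b ≠ Fin.last (q + 1)) ∨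
          (b = 0 ∧ a = c ∧ a ≠ 0 ∧ a ≠ Fin.last (q + 1)) ∨
          (c = 0 ∧ a = b ∧ a ≠ 0 ∧ a ≠ Fin.last (q + 1)) ∨
          (a = 0 ∧ b = 0 ∧ c = Fin.last (q + 1)) ∨
          (a = 0 ∧ b = Fin.last (q + 1) ∧ c = 0) ∨
          (a = Fin.last (q + 1) ∧ b = 0 ∧ c = 0) then (1 : K) else 0) p) :
    p ≤ 0.625 :=
  h.alpha_CW K q hq p hp

end Catalogue

end Literature.Barriers.MatrixMultiplication

end
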